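import Summits.ResolutionOfSingularities.ResolutionOfSingularities.Theorems.EquisingularLiftEquisingularLiftNatSubchainPointResolutionOff
import Summits.ResolutionOfSingularities.ResolutionOfSingularities.Theorems.EquisingularLiftEquisingularLiftNatSubchainSupplierInvSLDefs
import Summits.ResolutionOfSingularities.ResolutionOfSingularities.Theorems.EquisingularLiftEquisingularLiftNatDirZeroDefs
import HarnessLib

/-!
# [OURS · L1 W4.5(b) · EL♮(3) · WIDTH TABLE D5 «IMMATURE HOST», engine row] K5⁶ — THE LETTERED-PREFIX T-ISO ENGINE WITH A KEY-INCIDENCE TAG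
# `target_elnat_of_letteredPrefixResolution` = K5″ (✓ `target_elnat_of_subchainResolution_letters`, letters at the initial stage only) × K5ʰ v2.2
# (✓ `target_elnat_of_hostedSubchainResolution₂`, one host model in the state), widened to the state `Q F ρ T (Ls : List (Set F)) (Kp : Option (Set F × Set F × Set F))`
res-L1-w45b-stub-2 g16 (desk R53 (2): «the K5⁶ ENGINE THEOREM = stub-2 g16»; `hres` text v1.1 df0014a1b76d223c of this seat).  OURS; NOT a statement of any
manuscript ([Hironaka2017] is a candidate under adjudication, nothing of it is asserted); AI-written, weaker than expert review.  No `sorry`; standard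
axioms; DEF-FREE (parametric in the four downstairs predicates `Reach`, `ReachL`, `LS`, `Open`).  `--supports stmt-ResolutionOfSingularities-20148 --as helper`.

WHAT.  EL♮'s conclusion (unfolded `ELNatConclusionO k n H ι`) from a downstairs LETTERED-PREFIX resolution — a motive `Q F ρ T Ls Kp` (running strict
transform `T`, LISTED LETTERS `Ls`, KEY-INCIDENCE TAG `Kp = some (K, A, C)` «the key letter `K` contains the crossing curve of the letters `A`, `C`»)
closed under (0) START `[] none`, (D) DROP, (Pc) K5′ point steps + `Reach`-moves (letters dropped), (PL) K5″'s initial-stage lettered `ReachL`-towers,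
(i) LETTERED point steps, (O) `Open`-CERTIFIED OPENINGS, (ii) PAIR ROUNDS at the transversal crossing curve of two listed letters (the tag hosting or absent),
(HR) K5ʰ₂'s HOSTED ROUNDS in a listed host — and six upstairs suppliers in K5′'s currency: HSUB₁ (= K5″'s), HSUB₂ (= K5″'s), HPT⁶, HOPEN, HPAIR,
HROUND (= K5ʰ₂'s, ✓ `TCPlus.hround_seam`).  UPSTAIRS INVARIANT = K5′'s model square ∧ `∀ L ∈ Ls, TCPlus.LetterDatum …` ∧ the TAG BLOCK
`Kp = some (K, A, C) → ∃ 𝓚 𝓐 𝓒, LetterDatumWith K 𝓚 ∧ LetterDatumWith A 𝓐 ∧ LetterDatumWith C 𝓒 ∧ 𝓚 ≤ 𝓐 ⊔ 𝓒` (self-contained: the tag carries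
its own three models, so no joint naming function is needed).  PROOF = K5″'s model-square induction, each closure clause discharged by the supplier of the
same name; pure threading.  NOTES for suppliers/customers (res-L1-w45b-crit-3 F2/F5/F6): when the tag HOSTS a pair round, HPAIR builds the centre `𝒞 := 𝓐 ⊔ 𝓒` from
the TAG's models (that is where `𝓚 ≤ 𝓐 ⊔ 𝓒` lives), steps `A, B, K` from those by HT2′ and simply RE-CHOOSES the per-letter existentials of `St A, St B, St K` (models are
not unique; the per-letter blocks are independent existentials, so this is consistent); a PRESENT tag must host the round — a tagged state wanting another pair first drops
the tag by (D); (D)'s `∀ L ∈ Ls', L ∈ Ls` admits duplicates/reordering, harmless for the same reason. [folklore; K5′ (res-D-pv-029) + letters + a tag in the state]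
-/

set_option linter.dupNamespace false -- mandated namespace `Summit.<Summit>.<Problem>` of this single-conjunct summit
set_option linter.overlappingInstances false -- signatures carry `[IsDomain O] [IsDiscreteValuationRing O]`

noncomputable section

open CategoryTheory CategoryTheory.Limits AlgebraicGeometry TopologicalSpace Topology MvPolynomial
open Literature.AlgebraicGeometry.Motives (projectiveSpace)
open Literature.AlgebraicGeometry.Resolution AlgebraicGeometry.Scheme.IdealSheafData
open Summit.ResolutionOfSingularities.ResolutionOfSingularities.Theses.EquisingularLift.Split
open Summit.ResolutionOfSingularities.ResolutionOfSingularities.Cruxes.EquisingularLift.StrataSplit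

namespace Summit.ResolutionOfSingularities.ResolutionOfSingularities.Cruxes.EquisingularLiftNat.Sections
set_option maxHeartbeats 400000 in -- buildfix (bf3-g30): 160k/180k FAIL, 200k PASS at accept time; line-neutral budget line
/-- **K5⁶: the LETTERED-PREFIX T-ISO engine with a key-incidence tag** (any `n`; parametric in `Reach`, `ReachL`, `LS`, `Open`; conditional on the six
suppliers HSUB₁ / HSUB₂ / HPT⁶ / HOPEN / HPAIR / HROUND).  See the module docstring. [folklore; K5′ (res-D-pv-029) × K5″ × K5ʰ₂, letters and a tag in the state] -/
theorem target_elnat_of_letteredPrefixResolution (p : ℕ) : p.Prime → ∀ (k : Type) [Field k] [CharP k p] [IsAlgClosed k] (n : ℕ) (H : Scheme.{0}) (ι : H ⟶ (projectiveSpace n k).left),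
    IsClosedImmersion ι → IsIntegral H → (∀ y : (projectiveSpace n k).left, ∃ U : (projectiveSpace n k).left.affineOpens, y ∈ (U : (projectiveSpace n k).left.Opens) ∧ (ι.ker.ideal U).IsPrincipal) →
    -- the four downstairs predicates the engine is parametric in: K5′'s `Reach`, K5″'s `ReachL`/`LS`, and the certified opening `Open`
    ∀ (Reach : ∀ (F₁ F₂ : Scheme.{0}), (F₂ ⟶ F₁) → F₁ → Set F₂ → ∀ (F₉ : Scheme.{0}), (F₉ ⟶ F₂) → Set F₉ → Prop) (ReachL : ∀ (F₂ : Scheme.{0}), (F₂ ⟶ (projectiveSpace n k).left) → (projectiveSpace n k).left → Set F₂ → List (Set F₂) →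
        ∀ (F₉ : Scheme.{0}), (F₉ ⟶ F₂) → Set F₉ → Prop) (LS : ∀ (F₂ : Scheme.{0}), (F₂ ⟶ (projectiveSpace n k).left) → (projectiveSpace n k).left → List (Set F₂) → Prop)
      (Open : ∀ (F₃ : Scheme.{0}), (F₃ ⟶ (projectiveSpace n k).left) → Set F₃ → List (Set F₃) → Option (Set F₃ × Set F₃ × Set F₃) → Prop),
    -- HSUB₁(Reach): K5′'s SUB-CHAIN SUPPLIER after a point step (letters dropped) — K5″'s binder VERBATIM
    (∀ (O : Type) [CommRing O] [IsDomain O] [IsDiscreteValuationRing O] [IsAdicComplete (IsLocalRing.maximalIdeal O) O] [IsAlgClosed (IsLocalRing.ResidueField O)] (θ : O →+* k), Function.Surjective θ →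
      ∀ (P : Scheme.{0}) (q : P ⟶ Spec (.of O)) (Y : Set P) (Ch : ∀ X' : Scheme.{0}, (X' ⟶ P) → Set X' → Prop), (∀ (X' X'' : Scheme.{0}) (σ' : X' ⟶ P) (S' : Set X') (C : X'.IdealSheafData) (τ : X'' ⟶ X'), Ch X' σ' S' → IsBlowup τ C →
          Scheme.IsRegular C.subscheme → Flat (C.subschemeι ≫ σ' ≫ q) → σ' '' (C.support : Set X') ⊆ {y | ¬ IsGenericPoint y Y} → (C.support : Set X') ∩ (σ' ≫ q) ⁻¹' {IsLocalRing.closedPoint O} ⊆ S' →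
          Ch X'' (τ ≫ σ') (closure (τ ⁻¹' (S' \ (C.support : Set X'))))) → (∀ (X' : Scheme.{0}) (σ' : X' ⟶ P) (S' : Set X'), Ch X' σ' S' → Chain P Y X' σ' S') → Y ⊆ q ⁻¹' {IsLocalRing.closedPoint O} → IsIrreducible Y → IsClosed Y →
        IsIntegral P → IsLocallyNoetherian P → Scheme.IsRegular P → IsProper q → SmoothOfRelativeDimension n q →
      -- the stage before the point step and its model
      ∀ (X' : Scheme.{0}) (σ' : X' ⟶ P) (S' : Set X'), Ch X' σ' S' → IsIntegral X' → IsLocallyNoetherian X' → Scheme.IsRegular X' → IsDominant (σ' ≫ q) → ∀ (F₁ : Scheme.{0}), IsIntegral F₁ → ∀ (j : F₁ ⟶ X') (t : F₁ ⟶ Spec (.of k)),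
        IsPullback j t (σ' ≫ q) (Spec.map (CommRingCat.ofHom θ)) → ∀ (T₁ : Set F₁), IsClosed T₁ → IsIrreducible T₁ → j '' T₁ = S' →
      -- the point step: section, its blow-up, the new stage and its model
      ∀ (x : F₁) (hx : IsClosed ({x} : Set F₁)) (U : X'.Opens), Smooth (U.ι ≫ σ' ≫ q) → ∀ (s : Spec (.of O) ⟶ X'), s ≫ σ' ≫ q = 𝟙 _ → s (IsLocalRing.closedPoint O) ∈ U → s (IsLocalRing.closedPoint O) = j x →
        ringKrullDim (X'.presheaf.stalk (s (IsLocalRing.closedPoint O))) = ((n + 1 : ℕ) : WithBot ℕ∞) → IsRegularLocalRing (F₁.presheaf.stalk x) → (∀ c ∈ (s.ker.support : Set X'), ¬ IsGenericPoint (σ' c) Y) →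
      ∀ (X₁ : Scheme.{0}) (τ₁ : X₁ ⟶ X'), IsBlowup τ₁ s.ker → IsIntegral X₁ → IsLocallyNoetherian X₁ → Scheme.IsRegular X₁ → IsDominant ((τ₁ ≫ σ') ≫ q) → ∀ (F₂ : Scheme.{0}), IsIntegral F₂ → ∀ (υ : F₂ ⟶ F₁), IsBlowup υ
          (vanishingIdeal (⟨{x}, hx⟩ : Closeds F₁)) → ∀ (j₂ : F₂ ⟶ X₁) (t₂ : F₂ ⟶ Spec (.of k)), IsPullback j₂ t₂ ((τ₁ ≫ σ') ≫ q) (Spec.map (CommRingCat.ofHom θ)) → j₂ ≫ τ₁ = υ ≫ j → (s.ker.comap τ₁).comap j₂ =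
          (vanishingIdeal (⟨{x}, hx⟩ : Closeds F₁)).comap υ → IsIrreducible (closure (υ ⁻¹' (T₁ \ {x}))) → Ch X₁ (τ₁ ≫ σ') (j₂ '' closure (υ ⁻¹' (T₁ \ {x}))) →
      -- the admissible downstairs sub-chains are matched upstairs
      ∀ (F₉ : Scheme.{0}) (β : F₉ ⟶ F₂) (T₉ : Set F₉), Reach F₁ F₂ υ x (closure (υ ⁻¹' (T₁ \ {x}))) F₉ β T₉ → ∃ (X₉ : Scheme.{0}) (σ₉ : X₉ ⟶ P) (S₉ : Set X₉) (j₉ : F₉ ⟶ X₉) (t₉ : F₉ ⟶ Spec (.of k)),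
          Ch X₉ σ₉ S₉ ∧ IsIntegral X₉ ∧ IsLocallyNoetherian X₉ ∧ Scheme.IsRegular X₉ ∧ IsDominant (σ₉ ≫ q) ∧ IsPullback j₉ t₉ (σ₉ ≫ q) (Spec.map (CommRingCat.ofHom θ)) ∧ j₉ '' T₉ = S₉ ∧ IsClosed T₉ ∧ IsIrreducible T₉ ∧ IsIntegral F₉) →
    -- THE INITIAL-STAGE LETTERED SUPPLIER HSUB₂(ReachL, LS): the same, at the CONCRETE initial stage `(ℙⁿ_O, 𝟙, Y)` with model `ℙⁿ_k`
    (∀ (O : Type) [CommRing O] [IsDomain O] [IsDiscreteValuationRing O] [IsAdicComplete (IsLocalRing.maximalIdeal O) O]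
        [IsAlgClosed (IsLocalRing.ResidueField O)] (θ : O →+* k), Function.Surjective θ → (letI := MvPolynomial.gradedAlgebra (σ := Fin (n + 1)) (R := O);
       letI := MvPolynomial.gradedAlgebra (σ := Fin (n + 1)) (R := k); ∀ (φ : homogeneousSubmodule (Fin (n + 1)) O →+*ᵍ homogeneousSubmodule (Fin (n + 1)) k)
        (hφ' : HomogeneousIdeal.irrelevant (homogeneousSubmodule (Fin (n + 1)) k) ≤ (HomogeneousIdeal.irrelevant (homogeneousSubmodule (Fin (n + 1)) O)).map φ),
        (∀ s, φ s = MvPolynomial.map θ s) → ∀ (Ch : ∀ X' : Scheme.{0}, (X' ⟶ (Proj (homogeneousSubmodule (Fin (n + 1)) O))) → Set X' → Prop),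
        (∀ (X' X'' : Scheme.{0}) (σ' : X' ⟶ (Proj (homogeneousSubmodule (Fin (n + 1)) O))) (S' : Set X') (C : X'.IdealSheafData) (τ : X'' ⟶ X'), Ch X' σ' S' → IsBlowup τ C →
          Scheme.IsRegular C.subscheme → Flat (C.subschemeι ≫ σ' ≫ (Proj.toSpecZero (homogeneousSubmodule (Fin (n + 1)) O) ≫ Spec.map (CommRingCat.ofHom (algebraMap O (homogeneousSubmodule (Fin (n + 1)) O 0))))) →
          σ' '' (C.support : Set X') ⊆ {y | ¬ IsGenericPoint y (Set.range (ι ≫ Proj.map φ hφ' : H ⟶ Proj (homogeneousSubmodule (Fin (n + 1)) O)))} →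
          (C.support : Set X') ∩ (σ' ≫ (Proj.toSpecZero (homogeneousSubmodule (Fin (n + 1)) O) ≫ Spec.map (CommRingCat.ofHom (algebraMap O (homogeneousSubmodule (Fin (n + 1)) O 0))))) ⁻¹' {IsLocalRing.closedPoint O} ⊆ S' →
          Ch X'' (τ ≫ σ') (closure (τ ⁻¹' (S' \ (C.support : Set X'))))) → (∀ (X' : Scheme.{0}) (σ' : X' ⟶ (Proj (homogeneousSubmodule (Fin (n + 1)) O))) (S' : Set X'), Ch X' σ' S' →
          Chain (Proj (homogeneousSubmodule (Fin (n + 1)) O)) (Set.range (ι ≫ Proj.map φ hφ' : H ⟶ Proj (homogeneousSubmodule (Fin (n + 1)) O))) X' σ' S') →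
        (Set.range (ι ≫ Proj.map φ hφ' : H ⟶ Proj (homogeneousSubmodule (Fin (n + 1)) O))) ⊆ (Proj.toSpecZero (homogeneousSubmodule (Fin (n + 1)) O) ≫ Spec.map (CommRingCat.ofHom (algebraMap O (homogeneousSubmodule (Fin (n + 1)) O 0)))) ⁻¹' {IsLocalRing.closedPoint O} → IsIrreducible (Set.range (ι ≫ Proj.map φ hφ' : H ⟶ Proj (homogeneousSubmodule (Fin (n + 1)) O))) → IsClosed (Set.range (ι ≫ Proj.map φ hφ' : H ⟶ Proj (homogeneousSubmodule (Fin (n + 1)) O))) →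
        IsIntegral (Proj (homogeneousSubmodule (Fin (n + 1)) O)) → IsLocallyNoetherian (Proj (homogeneousSubmodule (Fin (n + 1)) O)) → Scheme.IsRegular (Proj (homogeneousSubmodule (Fin (n + 1)) O)) →
        IsProper (Proj.toSpecZero (homogeneousSubmodule (Fin (n + 1)) O) ≫ Spec.map (CommRingCat.ofHom (algebraMap O (homogeneousSubmodule (Fin (n + 1)) O 0)))) → SmoothOfRelativeDimension n (Proj.toSpecZero (homogeneousSubmodule (Fin (n + 1)) O) ≫ Spec.map (CommRingCat.ofHom (algebraMap O (homogeneousSubmodule (Fin (n + 1)) O 0)))) →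
      -- the INITIAL stage `(ℙⁿ_O, 𝟙, Y)` and its model `ℙⁿ_k` (the base model square `Proj.map φ`)
      Ch (Proj (homogeneousSubmodule (Fin (n + 1)) O)) (𝟙 (Proj (homogeneousSubmodule (Fin (n + 1)) O))) (Set.range (ι ≫ Proj.map φ hφ' : H ⟶ Proj (homogeneousSubmodule (Fin (n + 1)) O))) → IsDominant (𝟙 (Proj (homogeneousSubmodule (Fin (n + 1)) O)) ≫ (Proj.toSpecZero (homogeneousSubmodule (Fin (n + 1)) O) ≫ Spec.map (CommRingCat.ofHom (algebraMap O (homogeneousSubmodule (Fin (n + 1)) O 0))))) →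
      IsIntegral (projectiveSpace n k).left → ∀ (t : (projectiveSpace n k).left ⟶ Spec (.of k)),
        IsPullback (Proj.map φ hφ' : (projectiveSpace n k).left ⟶ Proj (homogeneousSubmodule (Fin (n + 1)) O)) t (𝟙 (Proj (homogeneousSubmodule (Fin (n + 1)) O)) ≫ (Proj.toSpecZero (homogeneousSubmodule (Fin (n + 1)) O) ≫ Spec.map (CommRingCat.ofHom (algebraMap O (homogeneousSubmodule (Fin (n + 1)) O 0))))) (Spec.map (CommRingCat.ofHom θ)) →
      IsClosed (Set.range ι) → IsIrreducible (Set.range ι) → (Proj.map φ hφ' : (projectiveSpace n k).left ⟶ Proj (homogeneousSubmodule (Fin (n + 1)) O)) '' Set.range ι = (Set.range (ι ≫ Proj.map φ hφ' : H ⟶ Proj (homogeneousSubmodule (Fin (n + 1)) O))) →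
      -- the point step: section, its blow-up, the new stage and its model
      ∀ (x : (projectiveSpace n k).left) (hx : IsClosed ({x} : Set (projectiveSpace n k).left)) (U : (Proj (homogeneousSubmodule (Fin (n + 1)) O)).Opens), Smooth (U.ι ≫ 𝟙 (Proj (homogeneousSubmodule (Fin (n + 1)) O)) ≫ (Proj.toSpecZero (homogeneousSubmodule (Fin (n + 1)) O) ≫ Spec.map (CommRingCat.ofHom (algebraMap O (homogeneousSubmodule (Fin (n + 1)) O 0))))) →
      ∀ (s : Spec (.of O) ⟶ (Proj (homogeneousSubmodule (Fin (n + 1)) O))), s ≫ 𝟙 (Proj (homogeneousSubmodule (Fin (n + 1)) O)) ≫ (Proj.toSpecZero (homogeneousSubmodule (Fin (n + 1)) O) ≫ Spec.map (CommRingCat.ofHom (algebraMap O (homogeneousSubmodule (Fin (n + 1)) O 0)))) = 𝟙 _ → s (IsLocalRing.closedPoint O) ∈ U →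
        s (IsLocalRing.closedPoint O) = (Proj.map φ hφ' : (projectiveSpace n k).left ⟶ Proj (homogeneousSubmodule (Fin (n + 1)) O)) x →
        ringKrullDim ((Proj (homogeneousSubmodule (Fin (n + 1)) O)).presheaf.stalk (s (IsLocalRing.closedPoint O))) = ((n + 1 : ℕ) : WithBot ℕ∞) → IsRegularLocalRing ((projectiveSpace n k).left.presheaf.stalk x) →
        (∀ c ∈ (s.ker.support : Set (Proj (homogeneousSubmodule (Fin (n + 1)) O))), ¬ IsGenericPoint ((𝟙 (Proj (homogeneousSubmodule (Fin (n + 1)) O)) : (Proj (homogeneousSubmodule (Fin (n + 1)) O)) ⟶ (Proj (homogeneousSubmodule (Fin (n + 1)) O))) c) (Set.range (ι ≫ Proj.map φ hφ' : H ⟶ Proj (homogeneousSubmodule (Fin (n + 1)) O)))) →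
      ∀ (X₁ : Scheme.{0}) (τ₁ : X₁ ⟶ (Proj (homogeneousSubmodule (Fin (n + 1)) O))), IsBlowup τ₁ s.ker → IsIntegral X₁ → IsLocallyNoetherian X₁ → Scheme.IsRegular X₁ →
        IsDominant ((τ₁ ≫ 𝟙 (Proj (homogeneousSubmodule (Fin (n + 1)) O))) ≫ (Proj.toSpecZero (homogeneousSubmodule (Fin (n + 1)) O) ≫ Spec.map (CommRingCat.ofHom (algebraMap O (homogeneousSubmodule (Fin (n + 1)) O 0))))) →
      ∀ (F₂ : Scheme.{0}), IsIntegral F₂ → ∀ (υ : F₂ ⟶ (projectiveSpace n k).left), IsBlowup υ (vanishingIdeal (⟨{x}, hx⟩ : Closeds (projectiveSpace n k).left)) → ∀ (j₂ : F₂ ⟶ X₁) (t₂ : F₂ ⟶ Spec (.of k)),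
        IsPullback j₂ t₂ ((τ₁ ≫ 𝟙 (Proj (homogeneousSubmodule (Fin (n + 1)) O))) ≫ (Proj.toSpecZero (homogeneousSubmodule (Fin (n + 1)) O) ≫ Spec.map (CommRingCat.ofHom (algebraMap O (homogeneousSubmodule (Fin (n + 1)) O 0))))) (Spec.map (CommRingCat.ofHom θ)) → j₂ ≫ τ₁ = υ ≫ (Proj.map φ hφ' : (projectiveSpace n k).left ⟶ Proj (homogeneousSubmodule (Fin (n + 1)) O)) →
        (s.ker.comap τ₁).comap j₂ = (vanishingIdeal (⟨{x}, hx⟩ : Closeds (projectiveSpace n k).left)).comap υ → IsIrreducible (closure (υ ⁻¹' (Set.range ι \ {x}))) →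
        Ch X₁ (τ₁ ≫ 𝟙 (Proj (homogeneousSubmodule (Fin (n + 1)) O))) (j₂ '' closure (υ ⁻¹' (Set.range ι \ {x}))) →
      -- the LETTERS and the admissible lettered downstairs sub-chains, matched upstairs
      ∀ (Ls₂ : List (Set F₂)), LS F₂ υ x Ls₂ → ∀ (F₉ : Scheme.{0}) (β : F₉ ⟶ F₂) (T₉ : Set F₉), ReachL F₂ υ x (closure (υ ⁻¹' (Set.range ι \ {x}))) Ls₂ F₉ β T₉ →
        ∃ (X₉ : Scheme.{0}) (σ₉ : X₉ ⟶ (Proj (homogeneousSubmodule (Fin (n + 1)) O))) (S₉ : Set X₉) (j₉ : F₉ ⟶ X₉) (t₉ : F₉ ⟶ Spec (.of k)), Ch X₉ σ₉ S₉ ∧ IsIntegral X₉ ∧ IsLocallyNoetherian X₉ ∧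
          Scheme.IsRegular X₉ ∧ IsDominant (σ₉ ≫ (Proj.toSpecZero (homogeneousSubmodule (Fin (n + 1)) O) ≫ Spec.map (CommRingCat.ofHom (algebraMap O (homogeneousSubmodule (Fin (n + 1)) O 0))))) ∧
          IsPullback j₉ t₉ (σ₉ ≫ (Proj.toSpecZero (homogeneousSubmodule (Fin (n + 1)) O) ≫ Spec.map (CommRingCat.ofHom (algebraMap O (homogeneousSubmodule (Fin (n + 1)) O 0))))) (Spec.map (CommRingCat.ofHom θ)) ∧ j₉ '' T₉ = S₉ ∧
          IsClosed T₉ ∧ IsIrreducible T₉ ∧ IsIntegral F₉)) →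
    -- HPT⁶: the LETTERED POINT STEP supplier — K5′'s point step WITH ≤ 1 listed letter through the point (nested section), the others AWAY, the tag AWAY,
    --       and the BIRTH of the exceptional letter `υ⁻¹{x}`; output = the new stage, its model square, every transported `LetterDatum`, the tag block transported
(∀ (O : Type) [CommRing O] [IsDomain O] [IsDiscreteValuationRing O] [IsAdicComplete (IsLocalRing.maximalIdeal O) O] [IsAlgClosed (IsLocalRing.ResidueField O)] (θ : O →+* k), Function.Surjective θ →
      ∀ (P : Scheme.{0}) (q : P ⟶ Spec (.of O)) (Y : Set P) (Ch : ∀ X' : Scheme.{0}, (X' ⟶ P) → Set X' → Prop), (∀ (X' X'' : Scheme.{0}) (σ' : X' ⟶ P) (S' : Set X') (C : X'.IdealSheafData) (τ : X'' ⟶ X'), Ch X' σ' S' → IsBlowup τ C →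
          Scheme.IsRegular C.subscheme → Flat (C.subschemeι ≫ σ' ≫ q) → σ' '' (C.support : Set X') ⊆ {y | ¬ IsGenericPoint y Y} → (C.support : Set X') ∩ (σ' ≫ q) ⁻¹' {IsLocalRing.closedPoint O} ⊆ S' →
          Ch X'' (τ ≫ σ') (closure (τ ⁻¹' (S' \ (C.support : Set X'))))) → (∀ (X' : Scheme.{0}) (σ' : X' ⟶ P) (S' : Set X'), Ch X' σ' S' → Chain P Y X' σ' S') → Y ⊆ q ⁻¹' {IsLocalRing.closedPoint O} → IsIrreducible Y → IsClosed Y →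
        IsIntegral P → IsLocallyNoetherian P → Scheme.IsRegular P → IsProper q → SmoothOfRelativeDimension n q →
      -- the stage and its model
      ∀ (X' : Scheme.{0}) (σ' : X' ⟶ P) (S' : Set X'), Ch X' σ' S' → IsIntegral X' → IsLocallyNoetherian X' → Scheme.IsRegular X' → IsDominant (σ' ≫ q) → ∀ (F₁ : Scheme.{0}), IsIntegral F₁ → ∀ (j : F₁ ⟶ X') (t : F₁ ⟶ Spec (.of k)),
        IsPullback j t (σ' ≫ q) (Spec.map (CommRingCat.ofHom θ)) → ∀ (T₁ : Set F₁), IsClosed T₁ → IsIrreducible T₁ → j '' T₁ = S' → ∀ (Ls : List (Set F₁)) (Kp : Option (Set F₁ × Set F₁ × Set F₁)), (∀ L ∈ Ls, TCPlus.LetterDatum O P q Y F₁ X' σ' j L) →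
        (∀ K A C : Set F₁, Kp = some (K, A, C) → (∃ (𝓚 𝓐 𝓒 : X'.IdealSheafData), (𝓚.comap j = vanishingIdeal (⟨closure K, isClosed_closure⟩ : Closeds F₁) ∧ (∀ z : X', (stalkIdeal 𝓚 z).IsPrincipal) ∧ Scheme.IsRegular 𝓚.subscheme ∧ σ' '' (𝓚.support : Set X') ⊆ {y : ↥P | ¬ IsGenericPoint y Y} ∧ Flat (𝓚.subschemeι ≫ σ' ≫ q)) ∧
            (𝓐.comap j = vanishingIdeal (⟨closure A, isClosed_closure⟩ : Closeds F₁) ∧ (∀ z : X', (stalkIdeal 𝓐 z).IsPrincipal) ∧ Scheme.IsRegular 𝓐.subscheme ∧ σ' '' (𝓐.support : Set X') ⊆ {y : ↥P | ¬ IsGenericPoint y Y} ∧ Flat (𝓐.subschemeι ≫ σ' ≫ q)) ∧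
            (𝓒.comap j = vanishingIdeal (⟨closure C, isClosed_closure⟩ : Closeds F₁) ∧ (∀ z : X', (stalkIdeal 𝓒 z).IsPrincipal) ∧ Scheme.IsRegular 𝓒.subscheme ∧ σ' '' (𝓒.support : Set X') ⊆ {y : ↥P | ¬ IsGenericPoint y Y} ∧ Flat (𝓒.subschemeι ≫ σ' ≫ q)) ∧ 𝓚 ≤ 𝓐 ⊔ 𝓒)) →
      ∀ (Lt : Option (Set F₁)) (x : ↥(vanishingIdeal (⟨closure T₁, isClosed_closure⟩ : Closeds F₁)).subscheme) (hx : IsClosed ({((vanishingIdeal (⟨closure T₁, isClosed_closure⟩ : Closeds F₁)).subschemeι x : F₁)} : Set F₁)),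
        ¬ IsRegularLocalRing ((vanishingIdeal (⟨closure T₁, isClosed_closure⟩ : Closeds F₁)).subscheme.presheaf.stalk x) → IsRegularLocalRing (F₁.presheaf.stalk ((vanishingIdeal (⟨closure T₁, isClosed_closure⟩ : Closeds F₁)).subschemeι x : F₁)) →
        (∀ L ∈ Ls, ((vanishingIdeal (⟨closure T₁, isClosed_closure⟩ : Closeds F₁)).subschemeι x : F₁) ∈ closure L → Lt = some L) →
        (∀ L : Set F₁, Lt = some L → L ∈ Ls ∧ ∀ e : ↥(redSub F₁ (closure L) isClosed_closure), (redSubι F₁ (closure L) isClosed_closure e : F₁) = ((vanishingIdeal (⟨closure T₁, isClosed_closure⟩ : Closeds F₁)).subschemeι x : F₁) →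
          IsRegularLocalRing ((redSub F₁ (closure L) isClosed_closure).presheaf.stalk e)) →
        (∀ K A C : Set F₁, Kp = some (K, A, C) → ((vanishingIdeal (⟨closure T₁, isClosed_closure⟩ : Closeds F₁)).subschemeι x : F₁) ∉ closure K ∧ ((vanishingIdeal (⟨closure T₁, isClosed_closure⟩ : Closeds F₁)).subschemeι x : F₁) ∉ closure A ∧ ((vanishingIdeal (⟨closure T₁, isClosed_closure⟩ : Closeds F₁)).subschemeι x : F₁) ∉ closure C) →
      ∀ (F₂ : Scheme.{0}) (υ : F₂ ⟶ F₁), IsBlowup υ (vanishingIdeal (⟨{((vanishingIdeal (⟨closure T₁, isClosed_closure⟩ : Closeds F₁)).subschemeι x : F₁)}, hx⟩ : Closeds F₁)) →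
        ∃ (X₉ : Scheme.{0}) (σ₉ : X₉ ⟶ P) (S₉ : Set X₉) (j₉ : F₂ ⟶ X₉) (t₉ : F₂ ⟶ Spec (.of k)), Ch X₉ σ₉ S₉ ∧ IsIntegral X₉ ∧ IsLocallyNoetherian X₉ ∧ Scheme.IsRegular X₉ ∧ IsDominant (σ₉ ≫ q) ∧
          IsPullback j₉ t₉ (σ₉ ≫ q) (Spec.map (CommRingCat.ofHom θ)) ∧ j₉ '' (closure (υ ⁻¹' (T₁ \ {((vanishingIdeal (⟨closure T₁, isClosed_closure⟩ : Closeds F₁)).subschemeι x : F₁)}))) = S₉ ∧ IsClosed (closure (υ ⁻¹' (T₁ \ {((vanishingIdeal (⟨closure T₁, isClosed_closure⟩ : Closeds F₁)).subschemeι x : F₁)}))) ∧ IsIrreducible (closure (υ ⁻¹' (T₁ \ {((vanishingIdeal (⟨closure T₁, isClosed_closure⟩ : Closeds F₁)).subschemeι x : F₁)}))) ∧ IsIntegral F₂ ∧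
          (∀ L ∈ Ls, TCPlus.LetterDatum O P q Y F₂ X₉ σ₉ j₉ (closure (υ ⁻¹' (L \ {((vanishingIdeal (⟨closure T₁, isClosed_closure⟩ : Closeds F₁)).subschemeι x : F₁)})))) ∧ TCPlus.LetterDatum O P q Y F₂ X₉ σ₉ j₉ (υ ⁻¹' {((vanishingIdeal (⟨closure T₁, isClosed_closure⟩ : Closeds F₁)).subschemeι x : F₁)}) ∧
          (∀ K A C : Set F₁, Kp = some (K, A, C) → (∃ (𝓚 𝓐 𝓒 : X₉.IdealSheafData), (𝓚.comap j₉ = vanishingIdeal (⟨closure (closure (υ ⁻¹' (K \ {((vanishingIdeal (⟨closure T₁, isClosed_closure⟩ : Closeds F₁)).subschemeι x : F₁)}))), isClosed_closure⟩ : Closeds F₂) ∧ (∀ z : X₉, (stalkIdeal 𝓚 z).IsPrincipal) ∧ Scheme.IsRegular 𝓚.subscheme ∧ σ₉ '' (𝓚.support : Set X₉) ⊆ {y : ↥P | ¬ IsGenericPoint y Y} ∧ Flat (𝓚.subschemeι ≫ σ₉ ≫ q)) ∧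
            (𝓐.comap j₉ = vanishingIdeal (⟨closure (closure (υ ⁻¹' (A \ {((vanishingIdeal (⟨closure T₁, isClosed_closure⟩ : Closeds F₁)).subschemeι x : F₁)}))), isClosed_closure⟩ : Closeds F₂) ∧ (∀ z : X₉, (stalkIdeal 𝓐 z).IsPrincipal) ∧ Scheme.IsRegular 𝓐.subscheme ∧ σ₉ '' (𝓐.support : Set X₉) ⊆ {y : ↥P | ¬ IsGenericPoint y Y} ∧ Flat (𝓐.subschemeι ≫ σ₉ ≫ q)) ∧
            (𝓒.comap j₉ = vanishingIdeal (⟨closure (closure (υ ⁻¹' (C \ {((vanishingIdeal (⟨closure T₁, isClosed_closure⟩ : Closeds F₁)).subschemeι x : F₁)}))), isClosed_closure⟩ : Closeds F₂) ∧ (∀ z : X₉, (stalkIdeal 𝓒 z).IsPrincipal) ∧ Scheme.IsRegular 𝓒.subscheme ∧ σ₉ '' (𝓒.support : Set X₉) ⊆ {y : ↥P | ¬ IsGenericPoint y Y} ∧ Flat (𝓒.subschemeι ≫ σ₉ ≫ q)) ∧ 𝓚 ≤ 𝓐 ⊔ 𝓒))) →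
    -- HOPEN(Open): the CERTIFIED-OPENING supplier — at the CONCRETE initial stage `(ℙⁿ_O, 𝟙, Y)` with model `ℙⁿ_k` (HSUB₂'s context VERBATIM),
    --        every `Open`-certified downstairs position is the special fibre of SOME upstairs stage carrying every listed letter's `LetterDatum` and the tag block
    (∀ (O : Type) [CommRing O] [IsDomain O] [IsDiscreteValuationRing O] [IsAdicComplete (IsLocalRing.maximalIdeal O) O]
        [IsAlgClosed (IsLocalRing.ResidueField O)] (θ : O →+* k), Function.Surjective θ → (letI := MvPolynomial.gradedAlgebra (σ := Fin (n + 1)) (R := O);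
       letI := MvPolynomial.gradedAlgebra (σ := Fin (n + 1)) (R := k); ∀ (φ : homogeneousSubmodule (Fin (n + 1)) O →+*ᵍ homogeneousSubmodule (Fin (n + 1)) k)
        (hφ' : HomogeneousIdeal.irrelevant (homogeneousSubmodule (Fin (n + 1)) k) ≤ (HomogeneousIdeal.irrelevant (homogeneousSubmodule (Fin (n + 1)) O)).map φ),
        (∀ s, φ s = MvPolynomial.map θ s) → ∀ (Ch : ∀ X' : Scheme.{0}, (X' ⟶ (Proj (homogeneousSubmodule (Fin (n + 1)) O))) → Set X' → Prop),
        (∀ (X' X'' : Scheme.{0}) (σ' : X' ⟶ (Proj (homogeneousSubmodule (Fin (n + 1)) O))) (S' : Set X') (C : X'.IdealSheafData) (τ : X'' ⟶ X'), Ch X' σ' S' → IsBlowup τ C →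
          Scheme.IsRegular C.subscheme → Flat (C.subschemeι ≫ σ' ≫ (Proj.toSpecZero (homogeneousSubmodule (Fin (n + 1)) O) ≫ Spec.map (CommRingCat.ofHom (algebraMap O (homogeneousSubmodule (Fin (n + 1)) O 0))))) →
          σ' '' (C.support : Set X') ⊆ {y | ¬ IsGenericPoint y (Set.range (ι ≫ Proj.map φ hφ' : H ⟶ Proj (homogeneousSubmodule (Fin (n + 1)) O)))} →
          (C.support : Set X') ∩ (σ' ≫ (Proj.toSpecZero (homogeneousSubmodule (Fin (n + 1)) O) ≫ Spec.map (CommRingCat.ofHom (algebraMap O (homogeneousSubmodule (Fin (n + 1)) O 0))))) ⁻¹' {IsLocalRing.closedPoint O} ⊆ S' →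
          Ch X'' (τ ≫ σ') (closure (τ ⁻¹' (S' \ (C.support : Set X'))))) → (∀ (X' : Scheme.{0}) (σ' : X' ⟶ (Proj (homogeneousSubmodule (Fin (n + 1)) O))) (S' : Set X'), Ch X' σ' S' →
          Chain (Proj (homogeneousSubmodule (Fin (n + 1)) O)) (Set.range (ι ≫ Proj.map φ hφ' : H ⟶ Proj (homogeneousSubmodule (Fin (n + 1)) O))) X' σ' S') →
        (Set.range (ι ≫ Proj.map φ hφ' : H ⟶ Proj (homogeneousSubmodule (Fin (n + 1)) O))) ⊆ (Proj.toSpecZero (homogeneousSubmodule (Fin (n + 1)) O) ≫ Spec.map (CommRingCat.ofHom (algebraMap O (homogeneousSubmodule (Fin (n + 1)) O 0)))) ⁻¹' {IsLocalRing.closedPoint O} → IsIrreducible (Set.range (ι ≫ Proj.map φ hφ' : H ⟶ Proj (homogeneousSubmodule (Fin (n + 1)) O))) → IsClosed (Set.range (ι ≫ Proj.map φ hφ' : H ⟶ Proj (homogeneousSubmodule (Fin (n + 1)) O))) →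
        IsIntegral (Proj (homogeneousSubmodule (Fin (n + 1)) O)) → IsLocallyNoetherian (Proj (homogeneousSubmodule (Fin (n + 1)) O)) → Scheme.IsRegular (Proj (homogeneousSubmodule (Fin (n + 1)) O)) →
        IsProper (Proj.toSpecZero (homogeneousSubmodule (Fin (n + 1)) O) ≫ Spec.map (CommRingCat.ofHom (algebraMap O (homogeneousSubmodule (Fin (n + 1)) O 0)))) → SmoothOfRelativeDimension n (Proj.toSpecZero (homogeneousSubmodule (Fin (n + 1)) O) ≫ Spec.map (CommRingCat.ofHom (algebraMap O (homogeneousSubmodule (Fin (n + 1)) O 0)))) →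
      -- the INITIAL stage `(ℙⁿ_O, 𝟙, Y)` and its model `ℙⁿ_k` (the base model square `Proj.map φ`)
      Ch (Proj (homogeneousSubmodule (Fin (n + 1)) O)) (𝟙 (Proj (homogeneousSubmodule (Fin (n + 1)) O))) (Set.range (ι ≫ Proj.map φ hφ' : H ⟶ Proj (homogeneousSubmodule (Fin (n + 1)) O))) → IsDominant (𝟙 (Proj (homogeneousSubmodule (Fin (n + 1)) O)) ≫ (Proj.toSpecZero (homogeneousSubmodule (Fin (n + 1)) O) ≫ Spec.map (CommRingCat.ofHom (algebraMap O (homogeneousSubmodule (Fin (n + 1)) O 0))))) →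
      IsIntegral (projectiveSpace n k).left → ∀ (t : (projectiveSpace n k).left ⟶ Spec (.of k)),
        IsPullback (Proj.map φ hφ' : (projectiveSpace n k).left ⟶ Proj (homogeneousSubmodule (Fin (n + 1)) O)) t (𝟙 (Proj (homogeneousSubmodule (Fin (n + 1)) O)) ≫ (Proj.toSpecZero (homogeneousSubmodule (Fin (n + 1)) O) ≫ Spec.map (CommRingCat.ofHom (algebraMap O (homogeneousSubmodule (Fin (n + 1)) O 0))))) (Spec.map (CommRingCat.ofHom θ)) →
      IsClosed (Set.range ι) → IsIrreducible (Set.range ι) → (Proj.map φ hφ' : (projectiveSpace n k).left ⟶ Proj (homogeneousSubmodule (Fin (n + 1)) O)) '' Set.range ι = (Set.range (ι ≫ Proj.map φ hφ' : H ⟶ Proj (homogeneousSubmodule (Fin (n + 1)) O))) →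
      ∀ (F₃ : Scheme.{0}) (ρ₃ : F₃ ⟶ (projectiveSpace n k).left) (T₃ : Set F₃) (Ls₃ : List (Set F₃)) (Kp₃ : Option (Set F₃ × Set F₃ × Set F₃)), Open F₃ ρ₃ T₃ Ls₃ Kp₃ →
        ∃ (X₉ : Scheme.{0}) (σ₉ : X₉ ⟶ (Proj (homogeneousSubmodule (Fin (n + 1)) O))) (S₉ : Set X₉) (j₉ : F₃ ⟶ X₉) (t₉ : F₃ ⟶ Spec (.of k)), Ch X₉ σ₉ S₉ ∧ IsIntegral X₉ ∧ IsLocallyNoetherian X₉ ∧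
          Scheme.IsRegular X₉ ∧ IsDominant (σ₉ ≫ (Proj.toSpecZero (homogeneousSubmodule (Fin (n + 1)) O) ≫ Spec.map (CommRingCat.ofHom (algebraMap O (homogeneousSubmodule (Fin (n + 1)) O 0))))) ∧
          IsPullback j₉ t₉ (σ₉ ≫ (Proj.toSpecZero (homogeneousSubmodule (Fin (n + 1)) O) ≫ Spec.map (CommRingCat.ofHom (algebraMap O (homogeneousSubmodule (Fin (n + 1)) O 0))))) (Spec.map (CommRingCat.ofHom θ)) ∧ j₉ '' T₃ = S₉ ∧
          IsClosed T₃ ∧ IsIrreducible T₃ ∧ IsIntegral F₃ ∧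
          (∀ L ∈ Ls₃, TCPlus.LetterDatum O (Proj (homogeneousSubmodule (Fin (n + 1)) O)) (Proj.toSpecZero (homogeneousSubmodule (Fin (n + 1)) O) ≫ Spec.map (CommRingCat.ofHom (algebraMap O (homogeneousSubmodule (Fin (n + 1)) O 0)))) (Set.range (ι ≫ Proj.map φ hφ' : H ⟶ Proj (homogeneousSubmodule (Fin (n + 1)) O))) F₃ X₉ σ₉ j₉ L) ∧
          (∀ K A C : Set F₃, Kp₃ = some (K, A, C) → (∃ (𝓚 𝓐 𝓒 : X₉.IdealSheafData), (𝓚.comap j₉ = vanishingIdeal (⟨closure K, isClosed_closure⟩ : Closeds F₃) ∧ (∀ z : X₉, (stalkIdeal 𝓚 z).IsPrincipal) ∧ Scheme.IsRegular 𝓚.subscheme ∧ σ₉ '' (𝓚.support : Set X₉) ⊆ {y : ↥(Proj (homogeneousSubmodule (Fin (n + 1)) O)) | ¬ IsGenericPoint y (Set.range (ι ≫ Proj.map φ hφ' : H ⟶ Proj (homogeneousSubmodule (Fin (n + 1)) O)))} ∧ Flat (𝓚.subschemeι ≫ σ₉ ≫ (Proj.toSpecZero (homogeneousSubmodule (Fin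 (n + 1)) O) ≫ Spec.map (CommRingCat.ofHom (algebraMap O (homogeneousSubmodule (Fin (n + 1)) O 0)))))) ∧
            (𝓐.comap j₉ = vanishingIdeal (⟨closure A, isClosed_closure⟩ : Closeds F₃) ∧ (∀ z : X₉, (stalkIdeal 𝓐 z).IsPrincipal) ∧ Scheme.IsRegular 𝓐.subscheme ∧ σ₉ '' (𝓐.support : Set X₉) ⊆ {y : ↥(Proj (homogeneousSubmodule (Fin (n + 1)) O)) | ¬ IsGenericPoint y (Set.range (ι ≫ Proj.map φ hφ' : H ⟶ Proj (homogeneousSubmodule (Fin (n + 1)) O)))} ∧ Flat (𝓐.subschemeι ≫ σ₉ ≫ (Proj.toSpecZero (homogeneousSubmodule (Fin (n + 1)) O) ≫ Spec.map (CommRingCat.ofHom (algebraMap O (homogeneousSubmodule (Fin (n + 1)) O 0)))))) ∧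
            (𝓒.comap j₉ = vanishingIdeal (⟨closure C, isClosed_closure⟩ : Closeds F₃) ∧ (∀ z : X₉, (stalkIdeal 𝓒 z).IsPrincipal) ∧ Scheme.IsRegular 𝓒.subscheme ∧ σ₉ '' (𝓒.support : Set X₉) ⊆ {y : ↥(Proj (homogeneousSubmodule (Fin (n + 1)) O)) | ¬ IsGenericPoint y (Set.range (ι ≫ Proj.map φ hφ' : H ⟶ Proj (homogeneousSubmodule (Fin (n + 1)) O)))} ∧ Flat (𝓒.subschemeι ≫ σ₉ ≫ (Proj.toSpecZero (homogeneousSubmodule (Fin (n + 1)) O) ≫ Spec.map (CommRingCat.ofHom (algebraMap O (homogeneousSubmodule (Fin (n + 1)) O 0)))))) ∧ 𝓚 ≤ 𝓐 ⊔ 𝓒)))) →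
    -- HPAIR: the PAIR-ROUND supplier — centre `𝓐 ⊔ 𝓑` of two listed letters crossing transversally along `Z` (pair-centre lemma), members by HT2′,
    --        the hosting key letter (if tagged) by HT2′ with `𝓚 ≤ 𝓐 ⊔ 𝓒`, every other letter «transversal to `Z` or away», BIRTH of `υ'⁻¹ Z`
(∀ (O : Type) [CommRing O] [IsDomain O] [IsDiscreteValuationRing O] [IsAdicComplete (IsLocalRing.maximalIdeal O) O] [IsAlgClosed (IsLocalRing.ResidueField O)] (θ : O →+* k), Function.Surjective θ →
      ∀ (P : Scheme.{0}) (q : P ⟶ Spec (.of O)) (Y : Set P) (Ch : ∀ X' : Scheme.{0}, (X' ⟶ P) → Set X' → Prop), (∀ (X' X'' : Scheme.{0}) (σ' : X' ⟶ P) (S' : Set X') (C : X'.IdealSheafData) (τ : X'' ⟶ X'), Ch X' σ' S' → IsBlowup τ C →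
          Scheme.IsRegular C.subscheme → Flat (C.subschemeι ≫ σ' ≫ q) → σ' '' (C.support : Set X') ⊆ {y | ¬ IsGenericPoint y Y} → (C.support : Set X') ∩ (σ' ≫ q) ⁻¹' {IsLocalRing.closedPoint O} ⊆ S' →
          Ch X'' (τ ≫ σ') (closure (τ ⁻¹' (S' \ (C.support : Set X'))))) → (∀ (X' : Scheme.{0}) (σ' : X' ⟶ P) (S' : Set X'), Ch X' σ' S' → Chain P Y X' σ' S') → Y ⊆ q ⁻¹' {IsLocalRing.closedPoint O} → IsIrreducible Y → IsClosed Y →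
        IsIntegral P → IsLocallyNoetherian P → Scheme.IsRegular P → IsProper q → SmoothOfRelativeDimension n q →
      -- the stage and its model
      ∀ (X' : Scheme.{0}) (σ' : X' ⟶ P) (S' : Set X'), Ch X' σ' S' → IsIntegral X' → IsLocallyNoetherian X' → Scheme.IsRegular X' → IsDominant (σ' ≫ q) → ∀ (F₁ : Scheme.{0}), IsIntegral F₁ → ∀ (j : F₁ ⟶ X') (t : F₁ ⟶ Spec (.of k)),
        IsPullback j t (σ' ≫ q) (Spec.map (CommRingCat.ofHom θ)) → ∀ (T₁ : Set F₁), IsClosed T₁ → IsIrreducible T₁ → j '' T₁ = S' → ∀ (Ls : List (Set F₁)) (Kp : Option (Set F₁ × Set F₁ × Set F₁)), (∀ L ∈ Ls, TCPlus.LetterDatum O P q Y F₁ X' σ' j L) →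
        (∀ K A C : Set F₁, Kp = some (K, A, C) → (∃ (𝓚 𝓐 𝓒 : X'.IdealSheafData), (𝓚.comap j = vanishingIdeal (⟨closure K, isClosed_closure⟩ : Closeds F₁) ∧ (∀ z : X', (stalkIdeal 𝓚 z).IsPrincipal) ∧ Scheme.IsRegular 𝓚.subscheme ∧ σ' '' (𝓚.support : Set X') ⊆ {y : ↥P | ¬ IsGenericPoint y Y} ∧ Flat (𝓚.subschemeι ≫ σ' ≫ q)) ∧
            (𝓐.comap j = vanishingIdeal (⟨closure A, isClosed_closure⟩ : Closeds F₁) ∧ (∀ z : X', (stalkIdeal 𝓐 z).IsPrincipal) ∧ Scheme.IsRegular 𝓐.subscheme ∧ σ' '' (𝓐.support : Set X') ⊆ {y : ↥P | ¬ IsGenericPoint y Y} ∧ Flat (𝓐.subschemeι ≫ σ' ≫ q)) ∧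
            (𝓒.comap j = vanishingIdeal (⟨closure C, isClosed_closure⟩ : Closeds F₁) ∧ (∀ z : X', (stalkIdeal 𝓒 z).IsPrincipal) ∧ Scheme.IsRegular 𝓒.subscheme ∧ σ' '' (𝓒.support : Set X') ⊆ {y : ↥P | ¬ IsGenericPoint y Y} ∧ Flat (𝓒.subschemeι ≫ σ' ≫ q)) ∧ 𝓚 ≤ 𝓐 ⊔ 𝓒)) →
      ∀ (A B Z : Set F₁) (hZ : IsClosed Z), A ∈ Ls → B ∈ Ls → A ≠ B → vanishingIdeal (⟨closure A, isClosed_closure⟩ : Closeds F₁) ⊔ vanishingIdeal (⟨closure B, isClosed_closure⟩ : Closeds F₁) = vanishingIdeal (⟨Z, hZ⟩ : Closeds F₁) →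
        Z ⊆ T₁ → ¬ T₁ ⊆ Z → (∀ z : ↥(redSub F₁ Z hZ), IsRegularLocalRing ((redSub F₁ Z hZ).presheaf.stalk z)) →
        (∀ z : ↥(redSub F₁ Z hZ), IsClosed ({z} : Set ↥(redSub F₁ Z hZ)) → ringKrullDim ((redSub F₁ Z hZ).presheaf.stalk z) = ((1 : ℕ) : WithBot ℕ∞)) → (∀ z ∈ Z, IsClosed ({z} : Set F₁) → IsRegularLocalRing (F₁.presheaf.stalk z)) →
        (∀ K A' C' : Set F₁, Kp = some (K, A', C') → K ∈ Ls ∧ K ≠ A ∧ K ≠ B ∧ ((A' = A ∧ C' = B) ∨ (A' = B ∧ C' = A))) → (∀ L ∈ Ls, L ≠ A → L ≠ B → (∀ K A' C' : Set F₁, Kp = some (K, A', C') → L ≠ K) →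
          vanishingIdeal (⟨closure L, isClosed_closure⟩ : Closeds F₁) ⊔ vanishingIdeal (⟨Z, hZ⟩ : Closeds F₁) = vanishingIdeal (⟨closure L ∩ Z, isClosed_closure.inter hZ⟩ : Closeds F₁) ∧ ∀ z ∈ Z, IsClosed ({z} : Set F₁) →
            ¬ stalkIdeal (vanishingIdeal (⟨closure L, isClosed_closure⟩ : Closeds F₁)) z ≤ stalkIdeal (vanishingIdeal (⟨Z, hZ⟩ : Closeds F₁)) z) → ∀ (F₃ : Scheme.{0}) (υ' : F₃ ⟶ F₁), IsBlowup υ' (vanishingIdeal (⟨Z, hZ⟩ : Closeds F₁)) →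
        ∃ (X₉ : Scheme.{0}) (σ₉ : X₉ ⟶ P) (S₉ : Set X₉) (j₉ : F₃ ⟶ X₉) (t₉ : F₃ ⟶ Spec (.of k)), Ch X₉ σ₉ S₉ ∧ IsIntegral X₉ ∧ IsLocallyNoetherian X₉ ∧ Scheme.IsRegular X₉ ∧ IsDominant (σ₉ ≫ q) ∧
          IsPullback j₉ t₉ (σ₉ ≫ q) (Spec.map (CommRingCat.ofHom θ)) ∧ j₉ '' (closure (υ' ⁻¹' (T₁ \ Z))) = S₉ ∧ IsClosed (closure (υ' ⁻¹' (T₁ \ Z))) ∧ IsIrreducible (closure (υ' ⁻¹' (T₁ \ Z))) ∧ IsIntegral F₃ ∧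
          (∀ L ∈ Ls, TCPlus.LetterDatum O P q Y F₃ X₉ σ₉ j₉ (closure (υ' ⁻¹' (closure L \ Z)))) ∧ TCPlus.LetterDatum O P q Y F₃ X₉ σ₉ j₉ (υ' ⁻¹' Z)) →
    -- HROUND: the STAGE-LEVEL HOSTED ROUND supplier — (T-k) at the host's model (`nestRound_chain_of_fact`) + the host's strict-transform model (D4-3)
    (∀ (O : Type) [CommRing O] [IsDomain O] [IsDiscreteValuationRing O] [IsAdicComplete (IsLocalRing.maximalIdeal O) O] [IsAlgClosed (IsLocalRing.ResidueField O)] (θ : O →+* k), Function.Surjective θ →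
      ∀ (P : Scheme.{0}) (q : P ⟶ Spec (.of O)) (Y : Set P) (Ch : ∀ X' : Scheme.{0}, (X' ⟶ P) → Set X' → Prop), (∀ (X' X'' : Scheme.{0}) (σ' : X' ⟶ P) (S' : Set X') (C : X'.IdealSheafData) (τ : X'' ⟶ X'), Ch X' σ' S' → IsBlowup τ C →
          Scheme.IsRegular C.subscheme → Flat (C.subschemeι ≫ σ' ≫ q) → σ' '' (C.support : Set X') ⊆ {y | ¬ IsGenericPoint y Y} →
          (C.support : Set X') ∩ (σ' ≫ q) ⁻¹' {IsLocalRing.closedPoint O} ⊆ S' → Ch X'' (τ ≫ σ') (closure (τ ⁻¹' (S' \ (C.support : Set X'))))) → (∀ (X' : Scheme.{0}) (σ' : X' ⟶ P) (S' : Set X'), Ch X' σ' S' →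
          Chain P Y X' σ' S') → Y ⊆ q ⁻¹' {IsLocalRing.closedPoint O} → IsIrreducible Y → IsClosed Y → IsIntegral P → IsLocallyNoetherian P → Scheme.IsRegular P → IsProper q → SmoothOfRelativeDimension n q →
      -- the stage before the point step and its model
      ∀ (X' : Scheme.{0}) (σ' : X' ⟶ P) (S' : Set X'), Ch X' σ' S' → IsIntegral X' → IsLocallyNoetherian X' → Scheme.IsRegular X' → IsDominant (σ' ≫ q) →
      ∀ (F₁ : Scheme.{0}), IsIntegral F₁ → ∀ (j : F₁ ⟶ X') (t : F₁ ⟶ Spec (.of k)), IsPullback j t (σ' ≫ q) (Spec.map (CommRingCat.ofHom θ)) → ∀ (T₁ : Set F₁), IsClosed T₁ → IsIrreducible T₁ → j '' T₁ = S' →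
      ∀ (E₁ : Set F₁), TCPlus.LetterDatum O P q Y F₁ X' σ' j E₁ →
      ∀ (Z : Set F₁) (hZ : IsClosed Z) (F₃ : Scheme.{0}) (υ' : F₃ ⟶ F₁), Z ⊆ closure E₁ → Z ⊆ T₁ → ¬ T₁ ⊆ Z → (∀ z : ↥(redSub F₁ Z hZ), IsRegularLocalRing ((redSub F₁ Z hZ).presheaf.stalk z)) →
        (∀ (i : redSub F₁ Z hZ ⟶ redSub F₁ (closure E₁) isClosed_closure), i ≫ redSubι F₁ (closure E₁) isClosed_closure = redSubι F₁ Z hZ →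
          ∀ z : ↥(redSub F₁ Z hZ), IsRegularLocalRing ((redSub F₁ (closure E₁) isClosed_closure).presheaf.stalk (i z))) → DirStepUnobs F₁ (closure E₁) isClosed_closure Z hZ →
        (∀ z : ↥(redSub F₁ Z hZ), IsClosed ({z} : Set ↥(redSub F₁ Z hZ)) → ringKrullDim ((redSub F₁ Z hZ).presheaf.stalk z) = ((1 : ℕ) : WithBot ℕ∞)) → IsBlowup υ' (vanishingIdeal (⟨Z, hZ⟩ : Closeds F₁)) →
        ∃ (X₉ : Scheme.{0}) (σ₉ : X₉ ⟶ P) (S₉ : Set X₉) (j₉ : F₃ ⟶ X₉) (t₉ : F₃ ⟶ Spec (.of k)), Ch X₉ σ₉ S₉ ∧ IsIntegral X₉ ∧ IsLocallyNoetherian X₉ ∧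
          Scheme.IsRegular X₉ ∧ IsDominant (σ₉ ≫ q) ∧ IsPullback j₉ t₉ (σ₉ ≫ q) (Spec.map (CommRingCat.ofHom θ)) ∧ j₉ '' (closure (υ' ⁻¹' (T₁ \ Z))) = S₉ ∧
          IsIrreducible (closure (υ' ⁻¹' (T₁ \ Z))) ∧ IsIntegral F₃ ∧ TCPlus.LetterDatum O P q Y F₃ X₉ σ₉ j₉ (closure (υ' ⁻¹' (closure E₁ \ Z)))) →
    -- the downstairs LETTERED-PREFIX resolution: `PrefixReach6`'s `∀ Q` block VERBATIM (text v1.1 df0014a1b76d223c) ∧ the end is regular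
    (∃ (F' : Scheme.{0}) (ρ' : F' ⟶ (projectiveSpace n k).left) (T' : Set F'), (∀ Q : (∀ F₁ : Scheme.{0}, (F₁ ⟶ (projectiveSpace n k).left) → Set F₁ → List (Set F₁) → Option (Set F₁ × Set F₁ × Set F₁) → Prop),
        -- (0) START: no letters, no tag
        Q (projectiveSpace n k).left (𝟙 (projectiveSpace n k).left) (Set.range ι) [] none →
        -- (D) DROP: forget listed letters (any sublist, as a set of names) and/or the tag
        (∀ (F₁ : Scheme.{0}) (ρ : F₁ ⟶ (projectiveSpace n k).left) (T₁ : Set F₁) (Ls Ls' : List (Set F₁)) (Kp Kp' : Option (Set F₁ × Set F₁ × Set F₁)), Q F₁ ρ T₁ Ls Kp → (∀ L ∈ Ls', L ∈ Ls) → (Kp' = Kp ∨ Kp' = none) → Q F₁ ρ T₁ Ls' Kp') →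
        -- (Pc) K5′'s POINT STEP + `Reach`-moves (PrefixReachBQuadPrime's first clause), from ANY slots, letters and tag DROPPED
        (∀ (F₁ F₂ : Scheme.{0}) (ρ : F₁ ⟶ (projectiveSpace n k).left) (T₁ : Set F₁) (Ls : List (Set F₁)) (Kp : Option (Set F₁ × Set F₁ × Set F₁)) (x : ↥(vanishingIdeal (⟨closure T₁, isClosed_closure⟩ : Closeds F₁)).subscheme) (υ : F₂ ⟶ F₁)
            (hx : IsClosed ({((vanishingIdeal (⟨closure T₁, isClosed_closure⟩ : Closeds F₁)).subschemeι x : F₁)} : Set F₁)), Q F₁ ρ T₁ Ls Kp → ¬ IsRegularLocalRing ((vanishingIdeal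
              (⟨closure T₁, isClosed_closure⟩ : Closeds F₁)).subscheme.presheaf.stalk x) → IsRegularLocalRing (F₁.presheaf.stalk ((vanishingIdeal (⟨closure T₁, isClosed_closure⟩ : Closeds F₁)).subschemeι x)) → IsBlowup υ
            (vanishingIdeal (⟨{((vanishingIdeal (⟨closure T₁, isClosed_closure⟩ : Closeds F₁)).subschemeι x : F₁)}, hx⟩ : Closeds F₁)) → Q F₂ (υ ≫ ρ) (closure (υ ⁻¹' (T₁ \ {((vanishingIdeal
              (⟨closure T₁, isClosed_closure⟩ : Closeds F₁)).subschemeι x : F₁)}))) [] none ∧ (∀ (F₉ : Scheme.{0}) (β : F₉ ⟶ F₂) (T₉ : Set F₉), Reach F₁ F₂ υ ((vanishingIdeal (⟨closure T₁, isClosed_closure⟩ : Closeds F₁)).subschemeι x)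
              (closure (υ ⁻¹' (T₁ \ {((vanishingIdeal (⟨closure T₁, isClosed_closure⟩ : Closeds F₁)).subschemeι x : F₁)}))) F₉ β T₉ → Q F₉ ((β ≫ υ) ≫ ρ) T₉ [] none)) →
        -- (PL) A⁗: at the INITIAL stage only, LETTERED `ReachL`-towers after a good point step (PrefixReachBQuadPrime's second clause), conclusion at `[] none`
        (∀ (F₂ : Scheme.{0}) (x₀ : ↥(vanishingIdeal (⟨closure (Set.range ι), isClosed_closure⟩ : Closeds (projectiveSpace n k).left)).subscheme) (υ : F₂ ⟶ (projectiveSpace n k).left) (hx₀ : IsClosed ({((vanishingIdeal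
              (⟨closure (Set.range ι), isClosed_closure⟩ : Closeds (projectiveSpace n k).left)).subschemeι x₀ : (projectiveSpace n k).left)} : Set (projectiveSpace n k).left)) (Ls₂ : List (Set F₂)), ¬ IsRegularLocalRing ((vanishingIdeal
              (⟨closure (Set.range ι), isClosed_closure⟩ : Closeds (projectiveSpace n k).left)).subscheme.presheaf.stalk x₀) → IsRegularLocalRing ((projectiveSpace n k).left.presheaf.stalk ((vanishingIdeal
              (⟨closure (Set.range ι), isClosed_closure⟩ : Closeds (projectiveSpace n k).left)).subschemeι x₀ : (projectiveSpace n k).left)) → IsBlowup υ (vanishingIdeal (⟨{((vanishingIdeal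
              (⟨closure (Set.range ι), isClosed_closure⟩ : Closeds (projectiveSpace n k).left)).subschemeι x₀ : (projectiveSpace n k).left)}, hx₀⟩ : Closeds (projectiveSpace n k).left)) → LS F₂ υ ((vanishingIdeal
              (⟨closure (Set.range ι), isClosed_closure⟩ : Closeds (projectiveSpace n k).left)).subschemeι x₀ : (projectiveSpace n k).left) Ls₂ → ∀ (F₉ : Scheme.{0}) (β : F₉ ⟶ F₂) (T₉ : Set F₉), ReachL F₂ υ ((vanishingIdeal
              (⟨closure (Set.range ι), isClosed_closure⟩ : Closeds (projectiveSpace n k).left)).subschemeι x₀ : (projectiveSpace n k).left) (closure (υ ⁻¹' (Set.range ι \ {((vanishingIdeal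
              (⟨closure (Set.range ι), isClosed_closure⟩ : Closeds (projectiveSpace n k).left)).subschemeι x₀ : (projectiveSpace n k).left)}))) Ls₂ F₉ β T₉ → Q F₉ (β ≫ υ) T₉ [] none) →
        -- (i) LETTERED POINT STEP at a closed non-regular point of `T̃`, regular on `F`: at most ONE listed letter THROUGH the point (`Lt = some L`: nested section,
        --     `L̃` regular at the point), every other listed letter AWAY, the tag's three letters AWAY; letters `↦ St`, tag `↦ St`, optional birth of `E_x = υ⁻¹{x}`
        (∀ (F₁ F₂ : Scheme.{0}) (ρ : F₁ ⟶ (projectiveSpace n k).left) (T₁ : Set F₁) (Ls : List (Set F₁)) (Kp : Option (Set F₁ × Set F₁ × Set F₁)) (Lt : Option (Set F₁))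
            (x : ↥(vanishingIdeal (⟨closure T₁, isClosed_closure⟩ : Closeds F₁)).subscheme) (υ : F₂ ⟶ F₁) (hx : IsClosed ({((vanishingIdeal (⟨closure T₁, isClosed_closure⟩ : Closeds F₁)).subschemeι x : F₁)} : Set F₁)), Q F₁ ρ T₁ Ls Kp →
          ¬ IsRegularLocalRing ((vanishingIdeal (⟨closure T₁, isClosed_closure⟩ : Closeds F₁)).subscheme.presheaf.stalk x) → IsRegularLocalRing (F₁.presheaf.stalk ((vanishingIdeal (⟨closure T₁, isClosed_closure⟩ : Closeds F₁)).subschemeι x)) →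
          (∀ L ∈ Ls, ((vanishingIdeal (⟨closure T₁, isClosed_closure⟩ : Closeds F₁)).subschemeι x : F₁) ∈ closure L → Lt = some L) →
          (∀ L : Set F₁, Lt = some L → L ∈ Ls ∧ ∀ e : ↥(redSub F₁ (closure L) isClosed_closure), (redSubι F₁ (closure L) isClosed_closure e : F₁) = ((vanishingIdeal (⟨closure T₁, isClosed_closure⟩ : Closeds F₁)).subschemeι x : F₁) →
            IsRegularLocalRing ((redSub F₁ (closure L) isClosed_closure).presheaf.stalk e)) → (∀ K A C : Set F₁, Kp = some (K, A, C) → ((vanishingIdeal (⟨closure T₁, isClosed_closure⟩ : Closeds F₁)).subschemeι x : F₁) ∉ closure K ∧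
            ((vanishingIdeal (⟨closure T₁, isClosed_closure⟩ : Closeds F₁)).subschemeι x : F₁) ∉ closure A ∧ ((vanishingIdeal (⟨closure T₁, isClosed_closure⟩ : Closeds F₁)).subschemeι x : F₁) ∉ closure C) → IsBlowup υ
            (vanishingIdeal (⟨{((vanishingIdeal (⟨closure T₁, isClosed_closure⟩ : Closeds F₁)).subschemeι x : F₁)}, hx⟩ : Closeds F₁)) → ∀ Ls' : List (Set F₂), (Ls' = Ls.map (fun L => closure (υ ⁻¹' (L \ {((vanishingIdeal
                (⟨closure T₁, isClosed_closure⟩ : Closeds F₁)).subschemeι x : F₁)}))) ∨ Ls' = Ls.map (fun L => closure (υ ⁻¹' (L \ {((vanishingIdeal (⟨closure T₁, isClosed_closure⟩ : Closeds F₁)).subschemeι x : F₁)}))) ++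
                [υ ⁻¹' {((vanishingIdeal (⟨closure T₁, isClosed_closure⟩ : Closeds F₁)).subschemeι x : F₁)}]) → Q F₂ (υ ≫ ρ) (closure (υ ⁻¹' (T₁ \ {((vanishingIdeal (⟨closure T₁, isClosed_closure⟩ : Closeds F₁)).subschemeι x : F₁)}))) Ls'
              (Kp.map (fun t => (closure (υ ⁻¹' (t.1 \ {((vanishingIdeal (⟨closure T₁, isClosed_closure⟩ : Closeds F₁)).subschemeι x : F₁)})), closure (υ ⁻¹' (t.2.1 \ {((vanishingIdeal
                  (⟨closure T₁, isClosed_closure⟩ : Closeds F₁)).subschemeι x : F₁)})), closure (υ ⁻¹' (t.2.2 \ {((vanishingIdeal (⟨closure T₁, isClosed_closure⟩ : Closeds F₁)).subschemeι x : F₁)})))))) →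
        -- (O) CERTIFIED OPENING (opaque here; Defs8: `Open := OpeningCert k n H ι`, S10's «birth of M♮ + P(x₀) + CAR + PROMOTE» certificate list, text v1.1)
        (∀ (F₃ : Scheme.{0}) (ρ₃ : F₃ ⟶ (projectiveSpace n k).left) (T₃ : Set F₃) (Ls₃ : List (Set F₃)) (Kp₃ : Option (Set F₃ × Set F₃ × Set F₃)), Open F₃ ρ₃ T₃ Ls₃ Kp₃ → Q F₃ ρ₃ T₃ Ls₃ Kp₃) →
        -- (ii) PAIR ROUND at the transversal crossing curve `Z` of two listed letters `A ≠ B` (stage-level, (T-k)-free): `Z ⊆ T`, `T ⊄ Z`, `Z̃` regular, curve clause,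
        --      `F` regular at the closed points of `Z`; the tag is absent or HOSTS (its pair is `{A, B}`, its key letter is listed and is not a member); every other
        --      listed letter does not contain `Z` and meets it transversally (possibly not at all); letters `↦ St`, tag consumed, optional birth of `E_Z = υ'⁻¹ Z`
        (∀ (F₁ F₃ : Scheme.{0}) (ρ : F₁ ⟶ (projectiveSpace n k).left) (T₁ : Set F₁) (Ls : List (Set F₁)) (Kp : Option (Set F₁ × Set F₁ × Set F₁)) (A B Z : Set F₁) (hZ : IsClosed Z) (υ' : F₃ ⟶ F₁), Q F₁ ρ T₁ Ls Kp → A ∈ Ls → B ∈ Ls → A ≠ B →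
          vanishingIdeal (⟨closure A, isClosed_closure⟩ : Closeds F₁) ⊔ vanishingIdeal (⟨closure B, isClosed_closure⟩ : Closeds F₁) = vanishingIdeal (⟨Z, hZ⟩ : Closeds F₁) →
          Z ⊆ T₁ → ¬ T₁ ⊆ Z → (∀ z : ↥(redSub F₁ Z hZ), IsRegularLocalRing ((redSub F₁ Z hZ).presheaf.stalk z)) →
          (∀ z : ↥(redSub F₁ Z hZ), IsClosed ({z} : Set ↥(redSub F₁ Z hZ)) → ringKrullDim ((redSub F₁ Z hZ).presheaf.stalk z) = ((1 : ℕ) : WithBot ℕ∞)) → (∀ z ∈ Z, IsClosed ({z} : Set F₁) → IsRegularLocalRing (F₁.presheaf.stalk z)) →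
          (∀ K A' C' : Set F₁, Kp = some (K, A', C') → K ∈ Ls ∧ K ≠ A ∧ K ≠ B ∧ ((A' = A ∧ C' = B) ∨ (A' = B ∧ C' = A))) → (∀ L ∈ Ls, L ≠ A → L ≠ B → (∀ K A' C' : Set F₁, Kp = some (K, A', C') → L ≠ K) →
            vanishingIdeal (⟨closure L, isClosed_closure⟩ : Closeds F₁) ⊔ vanishingIdeal (⟨Z, hZ⟩ : Closeds F₁) = vanishingIdeal (⟨closure L ∩ Z, isClosed_closure.inter hZ⟩ : Closeds F₁) ∧ ∀ z ∈ Z, IsClosed ({z} : Set F₁) →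
              ¬ stalkIdeal (vanishingIdeal (⟨closure L, isClosed_closure⟩ : Closeds F₁)) z ≤ stalkIdeal (vanishingIdeal (⟨Z, hZ⟩ : Closeds F₁)) z) → IsBlowup υ' (vanishingIdeal (⟨Z, hZ⟩ : Closeds F₁)) → ∀ Ls' : List (Set F₃),
            (Ls' = Ls.map (fun L => closure (υ' ⁻¹' (closure L \ Z))) ∨ Ls' = Ls.map (fun L => closure (υ' ⁻¹' (closure L \ Z))) ++ [υ' ⁻¹' Z]) → Q F₃ (υ' ≫ ρ) (closure (υ' ⁻¹' (T₁ \ Z))) Ls' none) →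
        -- (HR) HOSTED ROUND₂ inside a listed host `E₁ ∈ Ls` (K5ʰ v2.2's stage-level clause VERBATIM: regular curve `Z ⊆ closure E₁ ∩ T`, `Ẽ` regular along `Z̃`,
        --      `DirStepUnobs` in the host, curve clause), every OTHER letter and the tag DROPPED: output `[St E₁] none` (supplier = ✓ `TCPlus.hround_seam` after projection)
        (∀ (F₁ F₃ : Scheme.{0}) (ρ : F₁ ⟶ (projectiveSpace n k).left) (T₁ : Set F₁) (Ls : List (Set F₁)) (Kp : Option (Set F₁ × Set F₁ × Set F₁)) (E₁ : Set F₁) (Z : Set F₁) (hZ : IsClosed Z) (υ' : F₃ ⟶ F₁),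
          Q F₁ ρ T₁ Ls Kp → E₁ ∈ Ls → Z ⊆ closure E₁ → Z ⊆ T₁ → ¬ T₁ ⊆ Z → (∀ z : ↥(redSub F₁ Z hZ), IsRegularLocalRing ((redSub F₁ Z hZ).presheaf.stalk z)) →
          (∀ (i : redSub F₁ Z hZ ⟶ redSub F₁ (closure E₁) isClosed_closure), i ≫ redSubι F₁ (closure E₁) isClosed_closure = redSubι F₁ Z hZ →
            ∀ z : ↥(redSub F₁ Z hZ), IsRegularLocalRing ((redSub F₁ (closure E₁) isClosed_closure).presheaf.stalk (i z))) → DirStepUnobs F₁ (closure E₁) isClosed_closure Z hZ →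
          (∀ z : ↥(redSub F₁ Z hZ), IsClosed ({z} : Set ↥(redSub F₁ Z hZ)) → ringKrullDim ((redSub F₁ Z hZ).presheaf.stalk z) = ((1 : ℕ) : WithBot ℕ∞)) → IsBlowup υ' (vanishingIdeal (⟨Z, hZ⟩ : Closeds F₁)) →
          Q F₃ (υ' ≫ ρ) (closure (υ' ⁻¹' (T₁ \ Z))) [closure (υ' ⁻¹' (closure E₁ \ Z))] none) →
        -- END (C3): the final slots are existential
        ∃ (Ls : List (Set F')) (Kp : Option (Set F' × Set F' × Set F')), Q F' ρ' T' Ls Kp) ∧ Scheme.IsRegular (vanishingIdeal (⟨closure T', isClosed_closure⟩ : Closeds F')).subscheme) →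
    ∃ (O : Type) (_ : CommRing O) (_ : IsDomain O) (_ : IsDiscreteValuationRing O) (_ : CharZero O) (π : O →+* k),
      Function.Surjective π ∧ (letI := MvPolynomial.gradedAlgebra (σ := Fin (n + 1)) (R := O); letI := MvPolynomial.gradedAlgebra (σ := Fin (n + 1)) (R := k); ∀ (φ : homogeneousSubmodule (Fin (n + 1)) O →+*ᵍ homogeneousSubmodule (Fin (n + 1)) k)
          (hφ' : HomogeneousIdeal.irrelevant (homogeneousSubmodule (Fin (n + 1)) k) ≤ (HomogeneousIdeal.irrelevant (homogeneousSubmodule (Fin (n + 1)) O)).map φ), (∀ s, φ s = MvPolynomial.map π s) →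
          ∀ Y : Set (Proj (homogeneousSubmodule (Fin (n + 1)) O)), Y = Set.range (ι ≫ Proj.map φ hφ' : H ⟶ Proj (homogeneousSubmodule (Fin (n + 1)) O)) → ∃ (P' : Scheme.{0})
              (σ : P' ⟶ Proj (homogeneousSubmodule (Fin (n + 1)) O)) (S' : Set P'), (∀ Q : (∀ X' : Scheme.{0}, (X' ⟶ Proj (homogeneousSubmodule (Fin (n + 1)) O)) → Set X' → Prop),
                Q (Proj (homogeneousSubmodule (Fin (n + 1)) O)) (𝟙 _) Y → (∀ (X' X'' : Scheme.{0}) (σ' : X' ⟶ Proj (homogeneousSubmodule (Fin (n + 1)) O)) (Y' : Set X') (C : X'.IdealSheafData) (τ : X'' ⟶ X'),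
                  Q X' σ' Y' → IsBlowup τ C → Scheme.IsRegular C.subscheme → Flat (C.subschemeι ≫ σ' ≫ Proj.toSpecZero (homogeneousSubmodule (Fin (n + 1)) O) ≫ Spec.map (CommRingCat.ofHom (algebraMap O (homogeneousSubmodule (Fin (n + 1)) O 0)))) →
                  σ' '' (C.support : Set X') ⊆ {x | ¬ IsGenericPoint x Y} → (C.support : Set X') ∩ (σ' ≫ Proj.toSpecZero (homogeneousSubmodule (Fin (n + 1)) O) ≫ Spec.map (CommRingCat.ofHom
                        (algebraMap O (homogeneousSubmodule (Fin (n + 1)) O 0)))) ⁻¹' {IsLocalRing.closedPoint O} ⊆ Y' → Q X'' (τ ≫ σ') (closure (τ ⁻¹' (Y' \ (C.support : Set X'))))) → Q P' σ S') ∧ Scheme.IsRegular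
                (vanishingIdeal (⟨closure S', isClosed_closure⟩ : Closeds P')).subscheme):= by
  classical
  intro hp k _ _ _ n H ι hι hH hpr Reach ReachL LS Open HSUB HSUB₂ HPT HOPEN HPAIR HROUND hres; obtain ⟨O, i1, i2, i3, i4, i5, i6, π, hπ⟩ := stub_wittRing p hp k; refine ⟨O, i1, i2, i3, i4, π, hπ, ?_⟩
  letI := MvPolynomial.gradedAlgebra (σ := Fin (n + 1)) (R := O); letI := MvPolynomial.gradedAlgebra (σ := Fin (n + 1)) (R := k); intro φ hφ' hφ Y hYdef; subst hYdef
  -- the fixed ambient `P = ℙⁿ_O`, `q`, and the BASE MODEL SQUARE `g : ℙⁿ_k → ℙⁿ_O` (K5″ verbatim)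
  set q : Proj (homogeneousSubmodule (Fin (n + 1)) O) ⟶ Spec (.of O) := Proj.toSpecZero (homogeneousSubmodule (Fin (n + 1)) O) ≫ Spec.map (CommRingCat.ofHom (algebraMap O (homogeneousSubmodule (Fin (n + 1)) O 0))) with hq
  have hP := ProjectiveAmbientFibre.isPullback_projMap π φ hφ hπ hφ'; set g : Proj (homogeneousSubmodule (Fin (n + 1)) k) ⟶ Proj (homogeneousSubmodule (Fin (n + 1)) O) := Proj.map φ hφ' with hg
  haveI : IsClosedImmersion (Spec.map (CommRingCat.ofHom π)) := IsClosedImmersion.spec_of_surjective _ hπ; haveI : IsClosedImmersion g := MorphismProperty.IsStableUnderBaseChange.of_isPullback hP.flip inferInstance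
  have hsq₀ : IsPullback g (Proj.toSpecZero (homogeneousSubmodule (Fin (n + 1)) k) ≫ Spec.map (CommRingCat.ofHom (algebraMap k (homogeneousSubmodule (Fin (n + 1)) k 0)))) (𝟙 _ ≫ q) (Spec.map (CommRingCat.ofHom π)) := by
    rw [Category.id_comp]; exact hP
  have hrangeg : Set.range g = q ⁻¹' {IsLocalRing.closedPoint O} := by
    rw [range_eq_preimage_of_isPullback hP, range_specMap_of_surjective_of_field π hπ]
  -- the closed immersion `f = ι ≫ g : H ⟶ ℙⁿ_O` and its (closed) range `Y`
  haveI := hH; let ι' : H ⟶ Proj (homogeneousSubmodule (Fin (n + 1)) k) := ι; haveI : IsClosedImmersion ι' := hι; let f : H ⟶ Proj (homogeneousSubmodule (Fin (n + 1)) O) := ι' ≫ g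
  let Yc : Closeds (Proj (homogeneousSubmodule (Fin (n + 1)) O)) := ⟨Set.range f, f.isClosedEmbedding.isClosed_range⟩; have hYc : (Yc : Set (Proj (homogeneousSubmodule (Fin (n + 1)) O))) = Set.range (ι ≫ Proj.map φ hφ') := rfl
  have hsub : (Yc : Set (Proj (homogeneousSubmodule (Fin (n + 1)) O))) ⊆ q ⁻¹' {IsLocalRing.closedPoint O} := by
    rintro _ ⟨x, rfl⟩; rw [← hrangeg]; exact ⟨ι' x, (Scheme.Hom.comp_apply _ _ x).symm⟩
  obtain ⟨hsm, hprop⟩ := stub_projectiveAmbientSmoothProper O n; haveI : IsProper q := hprop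
  -- `Y` is irreducible (image of the integral `H`)
  have hYirr : IsIrreducible (Yc : Set (Proj (homogeneousSubmodule (Fin (n + 1)) O))) := by
    have h := (IrreducibleSpace.isIrreducible_univ H).image f f.continuous.continuousOn; rwa [Set.image_univ] at h
  obtain ⟨ξ, hξ⟩ : ∃ ξ : Proj (homogeneousSubmodule (Fin (n + 1)) O), IsGenericPoint ξ (Yc : Set _) := QuasiSober.sober hYirr Yc.isClosed
  -- EL♮'s HORIZONTAL induction principle as a stage predicate over the fixed base
  obtain ⟨Ch, hCh⟩ : ∃ Ch : ∀ X' : Scheme.{0}, (X' ⟶ Proj (homogeneousSubmodule (Fin (n + 1)) O)) → Set X' → Prop, ∀ (X₁ : Scheme.{0}) (σ₁ : X₁ ⟶ Proj (homogeneousSubmodule (Fin (n + 1)) O)) (S₁ : Set X₁), Ch X₁ σ₁ S₁ ↔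
      ∀ Q : (∀ X' : Scheme.{0}, (X' ⟶ Proj (homogeneousSubmodule (Fin (n + 1)) O)) → Set X' → Prop), Q (Proj (homogeneousSubmodule (Fin (n + 1)) O)) (𝟙 _) (Yc : Set (Proj (homogeneousSubmodule (Fin (n + 1)) O))) →
        (∀ (X' X'' : Scheme.{0}) (σ' : X' ⟶ Proj (homogeneousSubmodule (Fin (n + 1)) O)) (Y' : Set X') (C : X'.IdealSheafData) (τ : X'' ⟶ X'), Q X' σ' Y' → IsBlowup τ C → Scheme.IsRegular C.subscheme → Flat (C.subschemeι ≫ σ' ≫ q) →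
          σ' '' (C.support : Set X') ⊆ {x | ¬ IsGenericPoint x (Yc : Set (Proj (homogeneousSubmodule (Fin (n + 1)) O)))} → (C.support : Set X') ∩ (σ' ≫ q) ⁻¹' {IsLocalRing.closedPoint O} ⊆ Y' →
          Q X'' (τ ≫ σ') (closure (τ ⁻¹' (Y' \ (C.support : Set X'))))) → Q X₁ σ₁ S₁ := ⟨_, fun _ _ _ => Iff.rfl⟩; have hChain : ∀ (X' : Scheme.{0}) (σ : X' ⟶ Proj (homogeneousSubmodule (Fin (n + 1)) O)) (S : Set X'),
      Ch X' σ S → Chain (Proj (homogeneousSubmodule (Fin (n + 1)) O)) (Yc : Set (Proj (homogeneousSubmodule (Fin (n + 1)) O))) X' σ S := fun X' σ S h Q h0 hs => (hCh X' σ S).mp h Q h0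
      (fun X₁ X₂ σ' Y' C τ hQ hb hr _ hg' _ => hs X₁ X₂ σ' Y' C τ hQ hb hr hg'); have hStep : ∀ (X' X'' : Scheme.{0}) (σ' : X' ⟶ Proj (homogeneousSubmodule (Fin (n + 1)) O)) (S' : Set X') (C : X'.IdealSheafData) (τ : X'' ⟶ X'),
      Ch X' σ' S' → IsBlowup τ C → Scheme.IsRegular C.subscheme → Flat (C.subschemeι ≫ σ' ≫ q) → σ' '' (C.support : Set X') ⊆ {x | ¬ IsGenericPoint x (Yc : Set (Proj (homogeneousSubmodule (Fin (n + 1)) O)))} →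
      (C.support : Set X') ∩ (σ' ≫ q) ⁻¹' {IsLocalRing.closedPoint O} ⊆ S' → Ch X'' (τ ≫ σ') (closure (τ ⁻¹' (S' \ (C.support : Set X')))) := fun X' X'' σ' S' C τ h hb hr hfl hg' hE => (hCh _ _ _).mpr fun Q h0 hs =>
      hs X' X'' σ' S' C τ ((hCh X' σ' S').mp h Q h0 hs) hb hr hfl hg' hE; have hCh₀ : Ch (Proj (homogeneousSubmodule (Fin (n + 1)) O)) (𝟙 _) (Yc : Set (Proj (homogeneousSubmodule (Fin (n + 1)) O))) := (hCh _ _ _).mpr fun Q h0 _ => h0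
  have hPnoeth : IsLocallyNoetherian (Proj (homogeneousSubmodule (Fin (n + 1)) O)) := LocallyOfFiniteType.isLocallyNoetherian q
  have hPreg : Scheme.IsRegular (Proj (homogeneousSubmodule (Fin (n + 1)) O)) := fun y => (stub_goodAtOfSmooth O _ q hsm y).1; haveI hPint : IsIntegral (Proj (homogeneousSubmodule (Fin (n + 1)) O)) :=
    Proj.isIntegral _ (irrelevant_homogeneousSubmodule_ne_bot n O); haveI hsrd : SmoothOfRelativeDimension n q := smoothOfRelativeDimension_toSpecZero_specMap n O
  -- the INITIAL stage `(ℙⁿ_O, 𝟙, Y)` with model `ℙⁿ_k` (hoisted: used by the base case, (PL) and (O))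
  haveI : Nonempty H := inferInstance; haveI : Nonempty (Proj (homogeneousSubmodule (Fin (n + 1)) O)) := ⟨f (Classical.arbitrary H)⟩; haveI : Smooth q := hsm; haveI : IsDominant q := isDominant_of_smooth_of_nonempty q
  have hdom₀ : IsDominant (𝟙 (Proj (homogeneousSubmodule (Fin (n + 1)) O)) ≫ q) := by
    rw [Category.id_comp]; infer_instance
  have hirrι : IsIrreducible (Set.range ι') := by
    have h := (IrreducibleSpace.isIrreducible_univ H).image ι' ι'.continuous.continuousOn; rwa [Set.image_univ] at h
  have hT₁cl₀ : IsClosed (Set.range ι') := ι'.isClosedEmbedding.isClosed_range; haveI hF₁k : IsIntegral (Proj (homogeneousSubmodule (Fin (n + 1)) k)) := isIntegral_proj_homogeneousSubmodule n k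
  have hTS₀ : g '' Set.range ι' = (Yc : Set (Proj (homogeneousSubmodule (Fin (n + 1)) O))) := by
    change g '' Set.range ι' = Set.range f; rw [← Set.range_comp]; rfl
  -- THE INDUCTION PREDICATE: K5′'s model square ∧ every listed letter has a `TCPlus.LetterDatum` ∧ the TAG BLOCK (its own three models + the incidence)
  let QD : ∀ F₁ : Scheme.{0}, (F₁ ⟶ (projectiveSpace n k).left) → Set F₁ → List (Set F₁) → Option (Set F₁ × Set F₁ × Set F₁) → Prop := fun F₁ _ T₁ Ls Kp => IsClosed T₁ ∧ IsIrreducible T₁ ∧ IsIntegral F₁ ∧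
      ∃ (X' : Scheme.{0}) (σ' : X' ⟶ Proj (homogeneousSubmodule (Fin (n + 1)) O)) (S' : Set X') (j : F₁ ⟶ X') (t : F₁ ⟶ Spec (.of k)), Ch X' σ' S' ∧ IsIntegral X' ∧ IsLocallyNoetherian X' ∧ Scheme.IsRegular X' ∧ IsDominant (σ' ≫ q) ∧
        IsPullback j t (σ' ≫ q) (Spec.map (CommRingCat.ofHom π)) ∧ j '' T₁ = S' ∧ (∀ L ∈ Ls, TCPlus.LetterDatum O (Proj (homogeneousSubmodule (Fin (n + 1)) O)) q (Yc : Set (Proj (homogeneousSubmodule (Fin (n + 1)) O))) F₁ X' σ' j L) ∧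
        (∀ K A C : Set F₁, Kp = some (K, A, C) → ∃ (𝓚 𝓐 𝓒 : X'.IdealSheafData),
          (𝓚.comap j = vanishingIdeal (⟨closure K, isClosed_closure⟩ : Closeds F₁) ∧ (∀ z : X', (stalkIdeal 𝓚 z).IsPrincipal) ∧ Scheme.IsRegular 𝓚.subscheme ∧ σ' '' (𝓚.support : Set X') ⊆ {y : ↥(Proj (homogeneousSubmodule (Fin (n + 1)) O)) | ¬ IsGenericPoint y (Yc : Set (Proj (homogeneousSubmodule (Fin (n + 1)) O)))} ∧ Flat (𝓚.subschemeι ≫ σ' ≫ q)) ∧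
          (𝓐.comap j = vanishingIdeal (⟨closure A, isClosed_closure⟩ : Closeds F₁) ∧ (∀ z : X', (stalkIdeal 𝓐 z).IsPrincipal) ∧ Scheme.IsRegular 𝓐.subscheme ∧ σ' '' (𝓐.support : Set X') ⊆ {y : ↥(Proj (homogeneousSubmodule (Fin (n + 1)) O)) | ¬ IsGenericPoint y (Yc : Set (Proj (homogeneousSubmodule (Fin (n + 1)) O)))} ∧ Flat (𝓐.subschemeι ≫ σ' ≫ q)) ∧
          (𝓒.comap j = vanishingIdeal (⟨closure C, isClosed_closure⟩ : Closeds F₁) ∧ (∀ z : X', (stalkIdeal 𝓒 z).IsPrincipal) ∧ Scheme.IsRegular 𝓒.subscheme ∧ σ' '' (𝓒.support : Set X') ⊆ {y : ↥(Proj (homogeneousSubmodule (Fin (n + 1)) O)) | ¬ IsGenericPoint y (Yc : Set (Proj (homogeneousSubmodule (Fin (n + 1)) O)))} ∧ Flat (𝓒.subschemeι ≫ σ' ≫ q)) ∧ 𝓚 ≤ 𝓐 ⊔ 𝓒)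
  -- THE INDUCTION along the downstairs closure
  obtain ⟨F', ρ', T', hclos, hregD⟩ := hres; have hQD : ∃ (Ls : List (Set F')) (Kp : Option (Set F' × Set F' × Set F')), QD F' ρ' T' Ls Kp := by
    refine hclos QD ?_ ?_ ?_ ?_ ?_ ?_ ?_ ?_
    · -- (0) BASE: `(ℙⁿ_k, 𝟙, range ι, [], none)` IS the special fibre of `(ℙⁿ_O, 𝟙, Y)`; no letters, no tag
      refine ⟨hT₁cl₀, hirrι, hF₁k, _, 𝟙 _, (Yc : Set (Proj (homogeneousSubmodule (Fin (n + 1)) O))), g, _, hCh₀, hPint, hPnoeth, hPreg, hdom₀, hsq₀, hTS₀, fun L hL => by simp at hL, fun K A C h => by simp at h⟩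
    · -- (D) DROP
      intro F₁ ρ T₁ Ls Ls' Kp Kp' hQ₁ hsubL hKp'; obtain ⟨hT₁cl, hT₁irr, hF₁, X', σ', S', j, t, hChX, hX'int, hX'noeth, hX'reg, hdom, hsq, hTS, hLs, hTag⟩ := hQ₁
      refine ⟨hT₁cl, hT₁irr, hF₁, X', σ', S', j, t, hChX, hX'int, hX'noeth, hX'reg, hdom, hsq, hTS, fun L hL => hLs L (hsubL L hL), ?_⟩; rcases hKp' with rfl | rfl
      · exact hTag
      · intro K A C h; simp at h
    · -- (Pc) K5′ POINT STEPS + `Reach`-moves, letters and tag dropped (K5″'s STEPS case verbatim)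
      intro F₁ F₂ ρ T₁ Ls Kp x υ hx hQ₁ hxreg hFreg hυ; obtain ⟨hT₁cl, hT₁irr, hF₁, X', σ', S', j, t, hChX, hX'int, hX'noeth, hX'reg, hdom, hsq, hTS, -, -⟩ := hQ₁; haveI := hF₁; haveI := hX'int; haveI := hX'noeth
      obtain ⟨hF₂, hT₂irr, U, s, X'', τ, j₂, t₂, hproper, hU, hs, hsU, hss₀, hoffs, hτ, hcomm, hE, hCh'', hint'', hnoeth'',
        hreg'', hdom'', hsq₂⟩ := modelPointStep_chain' O k π hπ _ q (Yc : Set (Proj (homogeneousSubmodule (Fin (n + 1)) O))) hsub hYirr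
          Yc.isClosed hPnoeth hPreg Ch hChain hStep X' σ' S' hChX hX'reg hdom F₁ j t hsq T₁ hT₁cl hT₁irr hTS x hx hxreg hFreg F₂ υ hυ; haveI := hF₂; haveI := hint''; haveI := hnoeth''
      haveI hj₂ci : IsClosedImmersion j₂ := MorphismProperty.IsStableUnderBaseChange.of_isPullback hsq₂.flip inferInstance; refine ⟨⟨isClosed_closure, hT₂irr, hF₂, X'', τ ≫ σ', _, j₂, t₂, hCh'', hint'', hnoeth'', hreg'', hdom'', hsq₂, rfl,
        fun L hL => by simp at hL, fun K A C h => by simp at h⟩, ?_⟩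
      -- the sub-chain: handed to the supplier HSUB₁
      intro F₉ β T₉ hReach; haveI hjci : IsClosedImmersion j := MorphismProperty.IsStableUnderBaseChange.of_isPullback hsq.flip inferInstance; have hwcl : IsClosed ({s (IsLocalRing.closedPoint O)} : Set X') := by
        rw [hss₀]; have h := hjci.isClosedEmbedding.isClosedMap _ hx; rwa [Set.image_singleton] at h
      have hws₀ : (σ' ≫ q).base (s (IsLocalRing.closedPoint O)) = IsLocalRing.closedPoint O := by
        change (s ≫ σ' ≫ q) (IsLocalRing.closedPoint O) = _; rw [hs]; rfl
      have hdim : ringKrullDim (X'.presheaf.stalk (s (IsLocalRing.closedPoint O))) = ((n + 1 : ℕ) : WithBot ℕ∞) := ringKrullDim_stalk_eq_succ_of_chain q n hξ (hChain _ _ _ hChX) hwcl hws₀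
      obtain ⟨X₉, σ₉, S₉, j₉, t₉, hCh₉, hint₉, hnoeth₉, hreg₉, hdom₉, hsq₉, hsets₉, hT₉cl, hT₉irr, hF₉⟩ := HSUB O π hπ _ q (Yc : Set (Proj (homogeneousSubmodule (Fin (n + 1)) O))) Ch hStep hChain hsub hYirr Yc.isClosed
          hPint hPnoeth hPreg hprop hsrd X' σ' S' hChX hX'int hX'noeth hX'reg hdom F₁ hF₁ j t hsq T₁ hT₁cl hT₁irr hTS _ hx U hU s hs hsU hss₀ hdim hFreg hoffs X'' τ hτ hint'' hnoeth'' hreg'' hdom'' F₂ hF₂ υ hυ j₂ t₂ hsq₂ hcomm hE hT₂irr hCh''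
          F₉ β T₉ hReach; exact ⟨hT₉cl, hT₉irr, hF₉, X₉, σ₉, S₉, j₉, t₉, hCh₉, hint₉, hnoeth₉, hreg₉, hdom₉, hsq₉, hsets₉, fun L hL => by simp at hL, fun K A C h => by simp at h⟩
    · -- (PL) A⁗: LETTERED TOWERS AT THE INITIAL STAGE — the point step is run at the base stage `(ℙⁿ_O, 𝟙, Y)`, then HSUB₂ (K5″ verbatim)
      intro F₂ x₀ υ hx₀ Ls₂ hxreg hFreg hυ hLs F₉ β T₉ hReachL; obtain ⟨hF₂, hT₂irr, U, s, X'', τ, j₂, t₂, hproper, hU, hs, hsU, hss₀, hoffs, hτ, hcomm, hE, hCh'', hint'', hnoeth'',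
        hreg'', hdom'', hsq₂⟩ := modelPointStep_chain' O k π hπ _ q (Yc : Set (Proj (homogeneousSubmodule (Fin (n + 1)) O))) hsub hYirr
          Yc.isClosed hPnoeth hPreg Ch hChain hStep _ (𝟙 _) _ hCh₀ hPreg hdom₀ _ g _ hsq₀ (Set.range ι') hT₁cl₀ hirrι hTS₀ x₀ hx₀ hxreg hFreg F₂ υ hυ; haveI := hF₂; haveI := hint''; haveI := hnoeth''
      have hwcl : IsClosed ({s (IsLocalRing.closedPoint O)} : Set (Proj (homogeneousSubmodule (Fin (n + 1)) O))) := by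
        rw [hss₀]; have h := (inferInstance : IsClosedImmersion g).isClosedEmbedding.isClosedMap ({((Scheme.IdealSheafData.vanishingIdeal (⟨closure (Set.range ι), isClosed_closure⟩ :
              Closeds (Proj (homogeneousSubmodule (Fin (n + 1)) k)))).subschemeι x₀ : Proj (homogeneousSubmodule (Fin (n + 1)) k))} : Set (Proj (homogeneousSubmodule (Fin (n + 1)) k))) hx₀; rwa [Set.image_singleton] at h
      have hws₀ : (𝟙 (Proj (homogeneousSubmodule (Fin (n + 1)) O)) ≫ q).base (s (IsLocalRing.closedPoint O)) = IsLocalRing.closedPoint O := by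
        change (s ≫ 𝟙 _ ≫ q) (IsLocalRing.closedPoint O) = _; rw [hs]; rfl
      have hdim : ringKrullDim ((Proj (homogeneousSubmodule (Fin (n + 1)) O)).presheaf.stalk (s (IsLocalRing.closedPoint O))) = ((n + 1 : ℕ) : WithBot ℕ∞) := ringKrullDim_stalk_eq_succ_of_chain q n hξ (hChain _ _ _ hCh₀) hwcl hws₀
      obtain ⟨X₉, σ₉, S₉, j₉, t₉, hCh₉, hint₉, hnoeth₉, hreg₉, hdom₉, hsq₉, hsets₉, hT₉cl, hT₉irr, hF₉⟩ := HSUB₂ O π hπ φ hφ' hφ Ch hStep hChain hsub hYirr Yc.isClosed hPint hPnoeth hPreg hprop hsrd hCh₀ hdom₀ hF₁k _ hsq₀ hT₁cl₀ hirrι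
          hTS₀ _ hx₀ U hU s hs hsU hss₀ hdim hFreg hoffs X'' τ hτ hint'' hnoeth'' hreg'' hdom'' F₂ hF₂ υ hυ j₂ t₂ hsq₂ hcomm hE hT₂irr hCh'' Ls₂ hLs F₉ β T₉ hReachL
      exact ⟨hT₉cl, hT₉irr, hF₉, X₉, σ₉, S₉, j₉, t₉, hCh₉, hint₉, hnoeth₉, hreg₉, hdom₉, hsq₉, hsets₉, fun L hL => by simp at hL, fun K A C h => by simp at h⟩
    · -- (i) LETTERED POINT STEPS (HPT⁶)
      intro F₁ F₂ ρ T₁ Ls Kp Lt x υ hx hQ₁ hxreg hFreg hLt hLt' hKaway hυ Ls' hLs'; obtain ⟨hT₁cl, hT₁irr, hF₁, X', σ', S', j, t, hChX, hX'int, hX'noeth, hX'reg, hdom, hsq, hTS, hLs, hTag⟩ := hQ₁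
      obtain ⟨X₉, σ₉, S₉, j₉, t₉, hCh₉, hint₉, hnoeth₉, hreg₉, hdom₉, hsq₉, hsets₉, hT₉cl, hT₉irr, hF₂, hLs₉, hE₉, hTag₉⟩ := HPT O π hπ _ q (Yc : Set (Proj (homogeneousSubmodule (Fin (n + 1)) O))) Ch hStep hChain hsub hYirr Yc.isClosed hPint hPnoeth
          hPreg hprop hsrd X' σ' S' hChX hX'int hX'noeth hX'reg hdom F₁ hF₁ j t hsq T₁ hT₁cl hT₁irr hTS Ls Kp hLs hTag Lt x hx hxreg hFreg hLt hLt' hKaway F₂ υ hυ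
      refine ⟨hT₉cl, hT₉irr, hF₂, X₉, σ₉, S₉, j₉, t₉, hCh₉, hint₉, hnoeth₉, hreg₉, hdom₉, hsq₉, hsets₉, ?_, ?_⟩
      · rcases hLs' with rfl | rfl
        · intro L hL; obtain ⟨L₀, hL₀, rfl⟩ := List.mem_map.mp hL; exact hLs₉ L₀ hL₀
        · intro L hL; rcases List.mem_append.mp hL with hL | hL
          · obtain ⟨L₀, hL₀, rfl⟩ := List.mem_map.mp hL; exact hLs₉ L₀ hL₀
          · rw [List.mem_singleton] at hL; subst hL; exact hE₉
      · intro K A C hKAC; cases Kp with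
        | none => simp at hKAC
        | some t =>
          obtain ⟨K₀, A₀, C₀⟩ := t; simp only [Option.map_some, Option.some.injEq, Prod.mk.injEq] at hKAC; obtain ⟨rfl, rfl, rfl⟩ := hKAC; exact hTag₉ K₀ A₀ C₀ rfl
    · -- (O) CERTIFIED OPENINGS (HOPEN), at the initial stage
      intro F₃ ρ₃ T₃ Ls₃ Kp₃ hOpen; obtain ⟨X₉, σ₉, S₉, j₉, t₉, hCh₉, hint₉, hnoeth₉, hreg₉, hdom₉, hsq₉, hsets₉, hT₉cl, hT₉irr, hF₃, hLs₉, hTag₉⟩ :=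
        HOPEN O π hπ φ hφ' hφ Ch hStep hChain hsub hYirr Yc.isClosed hPint hPnoeth hPreg hprop hsrd hCh₀ hdom₀ hF₁k _ hsq₀ hT₁cl₀ hirrι hTS₀ F₃ ρ₃ T₃ Ls₃ Kp₃ hOpen
      exact ⟨hT₉cl, hT₉irr, hF₃, X₉, σ₉, S₉, j₉, t₉, hCh₉, hint₉, hnoeth₉, hreg₉, hdom₉, hsq₉, hsets₉, hLs₉, hTag₉⟩
    · -- (ii) PAIR ROUNDS (HPAIR)
      intro F₁ F₃ ρ T₁ Ls Kp A B Z hZ υ' hQ₁ hA hB hAB hcross hZT hTZ hZreg hZdim hFZreg hHost hOthers hυ' Ls' hLs'; obtain ⟨hT₁cl, hT₁irr, hF₁, X', σ', S', j, t, hChX, hX'int, hX'noeth, hX'reg, hdom, hsq, hTS, hLs, hTag⟩ := hQ₁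
      obtain ⟨X₉, σ₉, S₉, j₉, t₉, hCh₉, hint₉, hnoeth₉, hreg₉, hdom₉, hsq₉, hsets₉, hT₉cl, hT₉irr, hF₃, hLs₉, hE₉⟩ := HPAIR O π hπ _ q (Yc : Set (Proj (homogeneousSubmodule (Fin (n + 1)) O))) Ch hStep hChain hsub hYirr Yc.isClosed hPint hPnoeth
          hPreg hprop hsrd X' σ' S' hChX hX'int hX'noeth hX'reg hdom F₁ hF₁ j t hsq T₁ hT₁cl hT₁irr hTS Ls Kp hLs hTag A B Z hZ hA hB hAB hcross hZT hTZ hZreg hZdim hFZreg hHost hOthers F₃ υ' hυ'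
      refine ⟨hT₉cl, hT₉irr, hF₃, X₉, σ₉, S₉, j₉, t₉, hCh₉, hint₉, hnoeth₉, hreg₉, hdom₉, hsq₉, hsets₉, ?_, fun K A C h => by simp at h⟩; rcases hLs' with rfl | rfl
      · intro L hL; obtain ⟨L₀, hL₀, rfl⟩ := List.mem_map.mp hL; exact hLs₉ L₀ hL₀
      · intro L hL; rcases List.mem_append.mp hL with hL | hL
        · obtain ⟨L₀, hL₀, rfl⟩ := List.mem_map.mp hL; exact hLs₉ L₀ hL₀
        · rw [List.mem_singleton] at hL; subst hL; exact hE₉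
    · -- (HR) HOSTED ROUNDS in a listed host (HROUND = K5ʰ₂'s, ✓ `TCPlus.hround_seam`)
      intro F₁ F₃ ρ T₁ Ls Kp E₁ Z hZ υ' hQ₁ hE₁ hZE hZT hTZ hZreg hEreg hunobs hZdim hυ'; obtain ⟨hT₁cl, hT₁irr, hF₁, X', σ', S', j, t, hChX, hX'int, hX'noeth, hX'reg, hdom, hsq, hTS, hLs, -⟩ := hQ₁
      obtain ⟨X₉, σ₉, S₉, j₉, t₉, hCh₉, hint₉, hnoeth₉, hreg₉, hdom₉, hsq₉, hsets₉, hT₉irr, hF₃, hL₉⟩ := HROUND O π hπ _ q (Yc : Set (Proj (homogeneousSubmodule (Fin (n + 1)) O))) Ch hStep hChain hsub hYirr Yc.isClosed hPint hPnoeth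
          hPreg hprop hsrd X' σ' S' hChX hX'int hX'noeth hX'reg hdom F₁ hF₁ j t hsq T₁ hT₁cl hT₁irr hTS E₁ (hLs E₁ hE₁) Z hZ F₃ υ' hZE hZT hTZ hZreg hEreg hunobs hZdim hυ'
      refine ⟨isClosed_closure, hT₉irr, hF₃, X₉, σ₉, S₉, j₉, t₉, hCh₉, hint₉, hnoeth₉, hreg₉, hdom₉, hsq₉, hsets₉, ?_, fun K A C h => by simp at h⟩; intro L hL; rw [List.mem_singleton] at hL; subst hL; exact hL₉
  -- THE END: transport the downstairs regularity through the model (K5″ verbatim)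
  obtain ⟨Ls', Kp', hT'cl, -, -, X₁, σ₁, S₁, j₁, t₁, hCh₁, -, -, -, -, hsq₁, hTS₁, -, -⟩ := hQD; haveI hj₁ci : IsClosedImmersion j₁ := MorphismProperty.IsStableUnderBaseChange.of_isPullback hsq₁.flip inferInstance
  have hT'img : IsClosed (j₁ '' T') := hj₁ci.isClosedEmbedding.isClosedMap _ hT'cl; have hZ1 : (⟨closure T', isClosed_closure⟩ : Closeds F') = ⟨T', hT'cl⟩ := Closeds.ext hT'cl.closure_eq
  have hZ2 : (⟨closure S₁, isClosed_closure⟩ : Closeds X₁) = ⟨j₁ '' T', hT'img⟩ := Closeds.ext (by change closure S₁ = j₁ '' T'; rw [← hTS₁]; exact hT'img.closure_eq); rw [hZ1] at hregD; refine ⟨X₁, σ₁, S₁, (hCh X₁ σ₁ S₁).mp hCh₁, ?_⟩; rw [hZ2]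
  exact (isRegular_subscheme_vanishingIdeal_image_iff j₁ ⟨T', hT'cl⟩ hT'img).mpr hregD

end Summit.ResolutionOfSingularities.ResolutionOfSingularities.Cruxes.EquisingularLiftNat.Sections
end
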